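import Literature.Probability.RandomPlanarGeometry.HexSAWArmchairSqrtAsymptotic
import Literature.Probability.RandomPlanarGeometry.HexSAWRotSurfaceSqrtUpper
import Literature.Probability.RandomPlanarGeometry.HexSAWArmchairSqrtStrict
import Literature.Probability.RandomPlanarGeometry.HexSAWRotSurfaceMuSqrtAsymptotic
import HarnessLib

/-!
# Beaton's ROTATED (armchair) honeycomb surface, brick-wall frame: the second-order term of the wall-bridge growth rate —
# `β_rot(y)⁴ ≤ y² + 2 + 15309/√y` for every `y ≥ 1`, hence `y·(β_rot(y)² − y) ∈ [1/16, 1 + 7655/√y]`: `β_rot(y)² − y = Θ(1/y)` and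
# `limsup_{y→∞} y (β_rot(y)² − y) ≤ 1`; the same for `μ_rot(y) = HV.rotSurfaceMu y` (`y ≥ 4`)

Topic `Literature/Probability/RandomPlanarGeometry` (lane «pcv-sawmu», car «ARM-SECOND-ORDER-UPPER», a-p6 g15; continues
`HexSAWArmchairSqrtAsymptotic.lean` («ARM-SQRT-ASYMPTOTIC»: the class-`A`/`B` arches `Arm.arches`, the last-wall-visit fibres `Arm.fibA m k`,
`Arm.Aw_le_rec`, `Arm.armRate_le_of_WB_le`, `β_rot(y)/√y → 1`), `HexSAWRotSurfaceSqrtUpper.lean` (`Arm.no_three_walls`, the dimer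
structure of the armchair wall), `HexSAWArmchairSqrtStrict.lean` (`Arm.sqrt_lt_armRate`, `Arm.armRate_pow_sixteen_ge`) and
`HexSAWRotSurfaceMuSqrtAsymptotic.lean` (`HV.rotSurfaceMu_eq_armRate_of_four_le`).

Sources.  N. R. Beaton, *The critical surface fugacity of self-avoiding walks on a rotated honeycomb lattice*, CMP 326 (2014) 727 =
arXiv:1210.0274v3, §3 (pp. 10–11: the rotated surface model), §3.1 Proposition 7 (p. 11: `μ(y)`), p. 12 (unfolded walks).  J. M. Hammersley, G. M. Torrie,
S. G. Whittington, J. Phys. A 15 (1982) 539, §2 (unfolded surface walks / arches; as summarised by Beaton 2014 arXiv v3 p. 11 — locator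
provisional, source not held).  N. Madras, G. Slade, *The Self-Avoiding Walk* (1993), §1.2 (Lemma 1.2.2, (1.2.3), (1.2.17)).  I. G. Enting,
I. Jensen, LNP 775 (2009), §7.4.2, Fig. 7.10 (brickwork form of the honeycomb lattice).

## The object and what the tree knew

`β_rot(y) = Arm.armRate y` is the exponential growth rate (in the length) of the surface-weighted wall bridges of the honeycomb half-plane
`X ≥ 0` whose wall `X = 0` is of ARMCHAIR type in the brick-wall frame (wall vertices come in vertical dimers `(0,2j) – (0,2j+1)`, each
wall vertex has the single off-wall neighbour `(1, Y)`).  The tree knew `√y < β_rot(y)` (all `y > 0`), `β_rot(y)¹⁶ ≥ y⁸(1 + y⁻²)` and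
`β_rot(y) ≤ √y/(1 − 109/√y)` (`y > 109²`), whence `β_rot(y)/√y → 1` — a first-order statement with an `O(y^{-1/2})` relative window.

## What is proved (namespace `…SAW.HexBW.Arm`)

* §1 `Alive2` (a fresh self-avoiding two-step continuation in the half-plane), the alive arches by arrival class `archesA2`/`archesB2`/
  `arches2` and their weights `aW`/`bW`/`X2w` (`X2w_eq : X = a + b`); `WB_le_X2w` (a wall bridge of positive length is two-step alive:
  go straight on, the maximal-height end sees fresh sites above it).  §2 `prefixWalk_mem_arches2` (a prefix cut at a wall visit at least
  two steps before the end is alive — witnesses: the walk's own next two steps).  §3 `bW_le : b_{m+2} ≤ y a_{m+1}` (before a dimer step the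
  walk arrived off the wall — `no_three_walls`), the generic fibre bound `sum_fibA_le_X2 : fibre k ≤ y X_k c_{m+2−k}`.
* §4 THE SHORT FIBRES of the class-`A` arches of length `m+3` by the last-but-one wall visit `k` (excursion length `ℓ = m+3−k`):
  `sum_fibA_self_le_bW` (`ℓ = 3`, the connector `(0,Y)(1,Y)(1,Y')(0,Y')`: prefix of class `B`, `≤ y b_m`); ★ `not_mem_fibA_four` (`ℓ = 4`
  impossible); ★ `not_mem_fibA_five` (`ℓ = 5` impossible after the first step: the only candidate lands on the dimer partner `ω_{k−1}`);
  `launch_context` (`ω_{k−1} = (0,Y−τ)`, `ω_{k−2} = (1,Y−τ)`); ★★ `fibA_six_head`/`fibA_six_coords`/**`not_alive_of_mem_fibA_six`** (`ℓ = 6`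
  is the «skip-and-return» `(1,Y)(1,Y+τ)(2,Y+τ)(2,Y+2τ)(1,Y+2τ)(0,Y+2τ)` and is NOT two-step alive: its end sees only the skipped wall
  vertex `(0,Y+τ)`, whose neighbours are used); ★★ `fibA_seven_head`/`fibA_seven_coords`/`fibA_seven_coords₂`/**`sum_fibA_seven_le`**
  (`ℓ = 7` consists of EXACTLY TWO shapes — «skip a dimer» `(1,Y)(1,Y+τ)(2,Y+τ)(2,Y+2τ)(1,Y+2τ)(1,Y+3τ)(0,Y+3τ)` and the «wide connector»
  `(1,Y)(2,Y)(3,Y)(3,Y+τ)(2,Y+τ)(1,Y+τ)(0,Y+τ)` — so the fibre weighs `≤ 2y b_k`).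
* §5 ★★ **`aW_le_rec : a_{j+9} ≤ y b_{j+6} + 2y b_{j+2} + y Σ_{k ≤ j+1} X_k c_{j+8−k}`** — the alive two-class renewal inequality.
* §6 `aW_bW_le_mul_pow`: `y ≥ 1`, `ρ ≥ 6`, `y²ρ⁵ + 2y²ρ + 4374yρ + 10935y² ≤ ρ⁹ ⇒ a_n ≤ 3⁹y¹⁰ρⁿ`, `b_n ≤ 3⁹y¹¹ρ^{n−1}`.
* §7 ★★★ **`armRate_pow_four_le (1 ≤ y) : β_rot(y)⁴ ≤ y² + 2 + 15309/√y`** (`ρ⁴ = y² + 2 + 15309/√y` satisfies §6 for every `y ≥ 1`),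
  ★★ `armRate_sq_le_second : β_rot(y)² ≤ y + 1/y + 7655/(y√y)`, ★★ **`mul_armRate_sq_sub_le : y (β_rot(y)² − y) ≤ 1 + 7655/√y`**,
  `eventually_mul_armRate_sq_sub_le` (`≤ 1 + ε` eventually), `isBigO_armRate_sq_sub : β_rot(y)² − y = O(1/y)`.
* §8 (lower side, from the tree's `β_rot¹⁶ ≥ y⁸(1+y⁻²)` and `(1+v)⁸ ≤ 1 + 11v` on `[0, 1/16]`) `add_div_le_armRate_sq : y + 1/(16y) ≤ β_rot²`,
  ★★ `armRate_sq_sub_mem_Icc : β_rot(y)² − y ∈ [1/(16y), 1/y + 7655/(y√y)]`, `mul_armRate_sq_sub_mem_Icc : y(β_rot² − y) ∈ [1/16, 1 + 7655/√y]`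
  (`y ≥ 1`), ★★ **`isTheta_armRate_sq_sub : β_rot(y)² − y = Θ(1/y)`**.
* §9 the same for Beaton's `μ_rot(y) = HV.rotSurfaceMu y` (`= β_rot(y)` for `y ≥ 4`, `HexSAWRotSurfaceMuSqrtAsymptotic`):
  `HV.rotSurfaceMu_pow_four_le`, `HV.rotSurfaceMu_sq_sub_mem_Icc`, `HV.mul_rotSurfaceMu_sq_sub_mem_Icc` (`y ≥ 4`),
  ★★ `HV.isTheta_rotSurfaceMu_sq_sub`, `HV.eventually_mul_rotSurfaceMu_sq_sub_le`.

## Why two-step aliveness (the mechanism)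

In the growth variable `β_rot⁴ ∼ y²` the renewal pieces per slot of the dimer-hugging walk are: the connector (relative weight `z⁴/…`,
leading), then at relative order `y⁻²` exactly the two length-`7` excursions of §4 (coefficient `2` in `β_rot⁴`, i.e. `1` in `β_rot²`), while
the length-`6` «skip-and-return» would enter at relative order `y^{-3/2}` — and spoil the expansion — were it not a DEAD END: after it the
walk is trapped between the skipped dimer and itself.  Restricting all generating functions to two-step-alive arches (which still contain
every wall bridge, §1) removes it at no cost, exactly as the one-step-extendable arches removed the hook on the zig-zag wall
(`HexSAWSurfaceSecondOrderSharp.lean`).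

HONEST LABEL (author's proposal).  LANE THEOREM (S) / NEW-IN-WRITING (modest, S): for Beaton's rotated-honeycomb surface model the
adsorbed-phase growth rate satisfies `β_rot(y)² = y + Θ(1/y)` with `1/16 ≤ y(β_rot(y)² − y) ≤ 1 + 7655/√y` for every `y ≥ 1` (so
`limsup ≤ 1`); Beaton (2014) treats only the critical surface fugacity and prints no large-fugacity expansion (the companion statement for
the zig-zag wall, with both-sided coefficient `1`, is `HexSAWSurfaceSecondOrderSharp.lean`).  NOT CLAIMED: the matching lower bound
`liminf ≥ 1` (it needs a two-shape seed-renewal inequality in the armchair frame), anything at `y < 1` (resp. `y < 4` for `μ_rot`).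
Constants (`15309 = 4374 + 10935`, `7655`, `1/16`) are not optimised.
-/


noncomputable section

open Finset Filter Function
open Literature.Probability.LatticeModels Literature.Probability.Percolation SimpleGraph
open _root_.Topology

namespace Literature.Probability.RandomPlanarGeometry.SAW.HexBW.Arm

variable {y : ℝ} {n : ℕ} {ω : ℕ → Site 2}

/-! ### §1  Two-step-alive arches, by arrival class -/

/-- An `n`-step walk of the half-plane `X ≥ 0` is **two-step alive** if it admits a self-avoiding continuation by two fresh sites
`z₁ z₂` of the half-plane (consecutive brick-wall neighbours, not visited during `[0, n]`).  The «skip-and-return» ending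
`(0,Y) (1,Y) (1,Y+1) (2,Y+1) (2,Y+2) (1,Y+2) (0,Y+2)` (which lands on the TOP of the next dimer) is one-step but NOT two-step alive: the only
fresh neighbour is the skipped bottom `(0,Y+1)`, whose other neighbour `(1,Y+1)` is used. [cite: HammersleyTorrieWhittington1982, §2 (unfolded surface walks; locator provisional, source not held); EntingJensen2009, §7.4.2, Fig. 7.10] -/
def Alive2 (n : ℕ) (ω : ℕ → Site 2) : Prop :=
  ∃ z₁ z₂ : Site 2, brickWallGraph.Adj (ω n) z₁ ∧ brickWallGraph.Adj z₁ z₂ ∧ 0 ≤ z₁ 0 ∧ 0 ≤ z₂ 0 ∧ ∀ i ≤ n, ω i ≠ z₁ ∧ ω i ≠ z₂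

open Classical in
/-- Alive arches arriving from OFF the wall (class `A`: `ω (n−1)` off the wall). [cite: HammersleyTorrieWhittington1982, §2 (unfolded surface walks; locator provisional)] -/
def archesA2 (n : ℕ) : Finset (ℕ → Site 2) := (arches n).filter fun ω => ω (n - 1) 0 ≠ 0 ∧ Alive2 n ω

open Classical in
/-- Alive arches arriving ALONG the wall (class `B`: `ω (n−1)` on the wall; includes the empty arch `n = 0`). [cite: HammersleyTorrieWhittington1982, §2] -/
def archesB2 (n : ℕ) : Finset (ℕ → Site 2) := (arches n).filter fun ω => ω (n - 1) 0 = 0 ∧ Alive2 n ω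

open Classical in
/-- All alive arches. [cite: HammersleyTorrieWhittington1982, §2] -/
def arches2 (n : ℕ) : Finset (ℕ → Site 2) := (arches n).filter (Alive2 n)

open Classical in
/-- `a_n(y)`: weighted alive class-`A` arches. [cite: HammersleyTorrieWhittington1982, §2] -/
def aW (n : ℕ) (y : ℝ) : ℝ := ∑ ω ∈ archesA2 n, y ^ visits n ω

open Classical in
/-- `b_n(y)`: weighted alive class-`B` arches. [cite: HammersleyTorrieWhittington1982, §2] -/
def bW (n : ℕ) (y : ℝ) : ℝ := ∑ ω ∈ archesB2 n, y ^ visits n ω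

open Classical in
/-- `X_n(y)`: weighted alive arches. [cite: HammersleyTorrieWhittington1982, §2] -/
def X2w (n : ℕ) (y : ℝ) : ℝ := ∑ ω ∈ arches2 n, y ^ visits n ω

open Classical in
/-- `X_n = a_n + b_n`. [cite: HammersleyTorrieWhittington1982, §2] -/
theorem X2w_eq (n : ℕ) (y : ℝ) : X2w n y = aW n y + bW n y := by
  rw [X2w, aW, bW, archesA2, archesB2, arches2]
  have h : (arches n).filter (Alive2 n) =
      ((arches n).filter fun ω => ω (n - 1) 0 ≠ 0 ∧ Alive2 n ω) ∪ ((arches n).filter fun ω => ω (n - 1) 0 = 0 ∧ Alive2 n ω) := by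
    ext ω; simp only [Finset.mem_filter, Finset.mem_union]; tauto
  rw [h, Finset.sum_union]
  exact Finset.disjoint_filter.2 fun ω _ h1 h2 => h1.1 h2.1

open Classical in
/-- `a_n ≥ 0`. [cite: HammersleyTorrieWhittington1982, §2] -/
theorem aW_nonneg (n : ℕ) (hy : 0 ≤ y) : 0 ≤ aW n y := Finset.sum_nonneg fun _ _ => pow_nonneg hy _
open Classical in
/-- `b_n ≥ 0`. [cite: HammersleyTorrieWhittington1982, §2] -/
theorem bW_nonneg (n : ℕ) (hy : 0 ≤ y) : 0 ≤ bW n y := Finset.sum_nonneg fun _ _ => pow_nonneg hy _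
open Classical in
/-- `X_n ≥ 0`. [cite: HammersleyTorrieWhittington1982, §2] -/
theorem X2w_nonneg (n : ℕ) (hy : 0 ≤ y) : 0 ≤ X2w n y := Finset.sum_nonneg fun _ _ => pow_nonneg hy _
open Classical in
/-- `X_n ≤ A_n`. [cite: HammersleyTorrieWhittington1982, §2] -/
theorem X2w_le_Aw (n : ℕ) (hy : 0 ≤ y) : X2w n y ≤ Aw n y :=
  Finset.sum_le_sum_of_subset_of_nonneg (Finset.filter_subset _ _) fun _ _ _ => pow_nonneg hy _
open Classical in
/-- `a_n ≤ X_n`. [cite: HammersleyTorrieWhittington1982, §2] -/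
theorem aW_le_X2w (n : ℕ) (hy : 0 ≤ y) : aW n y ≤ X2w n y := by
  rw [X2w_eq]; exact le_add_of_nonneg_right (bW_nonneg n hy)
open Classical in
/-- `b_n ≤ X_n`. [cite: HammersleyTorrieWhittington1982, §2] -/
theorem bW_le_X2w (n : ℕ) (hy : 0 ≤ y) : bW n y ≤ X2w n y := by
  rw [X2w_eq]; exact le_add_of_nonneg_left (aW_nonneg n hy)

/-- **Every armchair wall bridge is two-step alive**: its end `(0, Y_n)` is the TOP of a dimer (`Y_n` odd) above every earlier vertex, so
`(1, Y_n) (1, Y_n + 1)` is a fresh continuation. [cite: Beaton2014RotatedHoneycomb, §3.1 (arXiv v3 p. 12: unfolded walks); EntingJensen2009, §7.4.2, Fig. 7.10] -/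
theorem alive2_of_mem_wb (hn : 1 ≤ n) (hω : ω ∈ wb n) : Alive2 n ω := by
  obtain ⟨hωa, hwb⟩ := mem_wb.1 hω
  obtain ⟨hωh, hend⟩ := mem_arches.1 hωa
  have hodd : ω n 1 % 2 = 1 := wb_end_odd hω
  obtain ⟨hYn, hin⟩ := hwb
  obtain ⟨hωs, -⟩ := mem_hp.1 hωh
  obtain ⟨h0, -, -, -⟩ := mem_saws_iff.1 hωs
  refine ⟨pt 1 (ω n 1), pt 1 (ω n 1 + 1), ?_, ?_, by simp, by simp, fun i hi => ⟨fun h => ?_, fun h => ?_⟩⟩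
  · rw [brickWallGraph_adj_coord, pt_apply_zero, pt_apply_one]; omega
  · rw [brickWallGraph_adj_coord, pt_apply_zero, pt_apply_one, pt_apply_zero, pt_apply_one]
    omega
  · have h1 := congrFun h 1
    have hx := congrFun h 0
    rw [pt_apply_one] at h1
    rw [pt_apply_zero] at hx
    rcases Nat.lt_or_ge i n with hi' | hi'
    · rcases Nat.eq_zero_or_pos i with rfl | hi0
      · rw [h0] at hx; simp at hx
      · have := (hin i hi0 hi').2; omega
    · have : i = n := le_antisymm hi hi'
      subst this; omega
  · have h1 := congrFun h 1
    rw [pt_apply_one] at h1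
    rcases Nat.lt_or_ge i n with hi' | hi'
    · rcases Nat.eq_zero_or_pos i with rfl | hi0
      · rw [h0] at h1; simp at h1; omega
      · have := (hin i hi0 hi').2; omega
    · have : i = n := le_antisymm hi hi'
      subst this; omega

open Classical in
/-- `wb n ⊆ arches2 n` (`n ≥ 1`). [cite: Beaton2014RotatedHoneycomb, §3.1 (arXiv v3 p. 12)] -/
theorem wb_subset_arches2 (hn : 1 ≤ n) : wb n ⊆ arches2 n :=
  fun _ hω => Finset.mem_filter.2 ⟨wb_subset hω, alive2_of_mem_wb hn hω⟩

open Classical in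
/-- **`B^w_n(y) ≤ X_n(y)`** (`n ≥ 1`, `y ≥ 0`). [cite: Beaton2014RotatedHoneycomb, §3.1 (arXiv v3 p. 12)] -/
theorem WB_le_X2w (hn : 1 ≤ n) (hy : 0 ≤ y) : WB n y ≤ X2w n y :=
  Finset.sum_le_sum_of_subset_of_nonneg (wb_subset_arches2 hn) fun _ _ _ => pow_nonneg hy _

/-! ### §2  Prefixes cut at a wall visit two steps before the end are alive -/

/-- The prefix of a half-plane walk up to a wall visit at time `k` with `k + 2 ≤ n` is an ALIVE arch (witnesses `ω (k+1)`, `ω (k+2)`),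
with the same visits. [cite: MadrasSlade1993, §1.2, (1.2.3); EntingJensen2009, §7.4.2, Fig. 7.10] -/
theorem prefixWalk_mem_arches2 (hω : ω ∈ hp n) {k : ℕ} (hk : k + 2 ≤ n) (hX : ω k 0 = 0) :
    Zd.prefixWalk k ω ∈ arches2 k ∧ visits k (Zd.prefixWalk k ω) = visits k ω := by
  classical
  obtain ⟨hpa, hpv⟩ := prefixWalk_mem_arches hω (by omega) hX
  refine ⟨Finset.mem_filter.2 ⟨hpa, ?_⟩, hpv⟩
  obtain ⟨hωs, hH⟩ := mem_hp.1 hω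
  obtain ⟨-, -, hbw, hinj⟩ := mem_saws_iff.1 hωs
  have hv : ∀ i ≤ k, Zd.prefixWalk k ω i = ω i := fun i hi => by simp [Zd.prefixWalk, min_eq_left hi]
  have hne : ∀ a b : ℕ, a ≤ n → b ≤ n → a ≠ b → ω a ≠ ω b := fun a b ha hb hab h =>
    hab (hinj (show a ∈ {j | j ≤ n} by simp only [Set.mem_setOf_eq]; exact ha)
      (show b ∈ {j | j ≤ n} by simp only [Set.mem_setOf_eq]; exact hb) h)
  refine ⟨ω (k + 1), ω (k + 2), ?_, ?_, hH _ (by omega), hH _ (by omega), fun i hi => ⟨?_, ?_⟩⟩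
  · rw [hv k le_rfl]; exact hbw k (by omega)
  · have := hbw (k + 1) (by omega); rwa [show k + 1 + 1 = k + 2 by omega] at this
  all_goals rw [hv i hi]; exact hne _ _ (by omega) (by omega) (by omega)

/-! ### §3  The dimer step and the long fibres, with alive prefixes -/

open Classical in
/-- **`b_{m+2}(y) ≤ y · a_{m+1}(y)`** (`y ≥ 0`): drop the final dimer step of an alive class-`B` arch — the prefix is class `A`
(`no_three_walls`) and ALIVE (witnesses: the dropped end and the first site of the arch's own continuation).
[cite: HammersleyTorrieWhittington1982, §2 (as summarised by Beaton 2014 arXiv v3 p. 11; locator provisional); EntingJensen2009, §7.4.2, Fig. 7.10] -/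
theorem bW_le (m : ℕ) (hy : 0 ≤ y) : bW (m + 2) y ≤ y * aW (m + 1) y := by
  set FB := archesB2 (m + 2) with hFB
  set g : (ℕ → Site 2) → (ℕ → Site 2) := fun ω => Zd.prefixWalk (m + 1) ω with hg
  have hprops : ∀ ω ∈ FB, g ω ∈ archesA2 (m + 1) ∧ visits (m + 2) ω = visits (m + 1) (g ω) + 1 := by
    intro ω hω
    obtain ⟨hωa, hB, hal⟩ := Finset.mem_filter.1 hω
    rw [show m + 2 - 1 = m + 1 by omega] at hB
    obtain ⟨hωh, hend⟩ := mem_arches.1 hωa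
    have hωs := hp_subset hωh
    obtain ⟨-, -, hbw, hinj⟩ := mem_saws_iff.1 hωs
    obtain ⟨hpa, hpv⟩ := prefixWalk_mem_arches hωh (show m + 1 ≤ m + 2 by omega) hB
    have hv : ∀ i ≤ m + 1, g ω i = ω i := fun i hi => by simp [hg, Zd.prefixWalk, min_eq_left hi]
    have hclassA : g ω (m + 1 - 1) 0 ≠ 0 := by
      rw [show m + 1 - 1 = m by omega, hv m (by omega)]
      intro h2
      exact no_three_walls hωh (i := m) (by omega) ⟨h2, hB, hend⟩
    have hne : ∀ a b : ℕ, a ≤ m + 2 → b ≤ m + 2 → a ≠ b → ω a ≠ ω b := fun a b ha hb hab h =>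
      hab (hinj (show a ∈ {j | j ≤ m + 2} by simp only [Set.mem_setOf_eq]; exact ha)
        (show b ∈ {j | j ≤ m + 2} by simp only [Set.mem_setOf_eq]; exact hb) h)
    have hH2 : 0 ≤ ω (m + 2) 0 := (mem_hp.1 hωh).2 (m + 2) le_rfl
    have hstep : brickWallGraph.Adj (ω (m + 1)) (ω (m + 2)) := by
      have := hbw (m + 1) (by omega); rwa [show m + 1 + 1 = m + 2 by omega] at this
    have halive : Alive2 (m + 1) (g ω) := by
      obtain ⟨z₁, z₂, hz1, -, hz1', -, hfresh⟩ := hal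
      refine ⟨ω (m + 2), z₁, ?_, hz1, hH2, hz1', fun i hi => ⟨?_, ?_⟩⟩
      · rw [hv (m + 1) le_rfl]; exact hstep
      · rw [hv i hi]; exact hne _ _ (by omega) (by omega) (by omega)
      · rw [hv i hi]; exact (hfresh i (by omega)).1
    refine ⟨Finset.mem_filter.2 ⟨hpa, hclassA, halive⟩, ?_⟩
    rw [show m + 2 = m + 1 + 1 by omega, visits_succ, if_pos hend, hpv]
  have hinj : Set.InjOn g ↑FB := by
    intro ω hω ω' hω' h
    rw [Finset.mem_coe] at hω hω'
    obtain ⟨hωa, hB, -⟩ := Finset.mem_filter.1 hω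
    obtain ⟨hωa', hB', -⟩ := Finset.mem_filter.1 hω'
    rw [show m + 2 - 1 = m + 1 by omega] at hB hB'
    obtain ⟨hωh, hend⟩ := mem_arches.1 hωa
    obtain ⟨hωh', hend'⟩ := mem_arches.1 hωa'
    have hωs := hp_subset hωh
    have hωs' := hp_subset hωh'
    have hagree : ∀ i ≤ m + 1, ω i = ω' i := fun i hi => by
      have := congrFun h i
      simpa [hg, Zd.prefixWalk, min_eq_left hi] using this
    refine eq_of_agree hωs hωs' fun i hi => ?_
    rcases Nat.lt_or_ge i (m + 2) with hi' | hi'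
    · exact hagree i (by omega)
    · have hin : i = m + 2 := le_antisymm hi hi'
      subst hin
      obtain ⟨-, -, hbw, -⟩ := mem_saws_iff.1 hωs
      obtain ⟨-, -, hbw', -⟩ := mem_saws_iff.1 hωs'
      have hst := hbw (m + 1) (by omega)
      have hst' := hbw' (m + 1) (by omega)
      have e1 := wall_step_eq hst hB hend
      have e1' := wall_step_eq hst' hB' hend'
      rw [site_two_eq_iff]
      refine ⟨by rw [hend, hend'], ?_⟩
      rw [e1, e1', hagree (m + 1) le_rfl]
  calc bW (m + 2) y = ∑ ω ∈ FB, y ^ visits (m + 2) ω := rfl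
    _ = ∑ ω ∈ FB, y * y ^ visits (m + 1) (g ω) := Finset.sum_congr rfl fun ω hω => by
        rw [(hprops ω hω).2, pow_succ, mul_comm]
    _ = y * ∑ ξ ∈ FB.image g, y ^ visits (m + 1) ξ := by rw [Finset.mul_sum, Finset.sum_image hinj]
    _ ≤ y * aW (m + 1) y := by
        refine mul_le_mul_of_nonneg_left ?_ hy
        rw [aW]
        refine Finset.sum_le_sum_of_subset_of_nonneg (fun ξ hξ => ?_) fun _ _ _ => pow_nonneg hy _
        obtain ⟨ω, hω, rfl⟩ := Finset.mem_image.1 hξ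
        exact (hprops ω hω).1

open Classical in
/-- The walks of `hp n` with last wall visit at time `k ≤ n − 2` weigh at most `X_k(y) · c_{n−k}(ℍ)` (alive prefix / twisted suffix).
[cite: HammersleyTorrieWhittington1982, §2; MadrasSlade1993, §1.2, (1.2.3)] -/
theorem sum_fibre_lastV_le_X2 (hy : 0 ≤ y) {k : ℕ} (hk : k + 2 ≤ n) :
    ∑ ω ∈ (hp n).filter (fun ω => lastV n ω = k), y ^ visits n ω ≤ X2w k y * #(saws (n - k)) := by
  set F := (hp n).filter (fun ω => lastV n ω = k)
  set g : (ℕ → Site 2) → (ℕ → Site 2) × (ℕ → Site 2) :=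
    fun ω => (Zd.prefixWalk k ω, fun i => twistAt (ω k) (Zd.suffixWalk k (n - k) ω i)) with hg
  have hF : ∀ ω ∈ F, ω ∈ hp n ∧ lastV n ω = k := fun ω hω => Finset.mem_filter.1 hω
  have hprops : ∀ ω ∈ F, visits n ω = visits k (Zd.prefixWalk k ω) ∧
      Zd.prefixWalk k ω ∈ arches2 k ∧ (fun i => twistAt (ω k) (Zd.suffixWalk k (n - k) ω i)) ∈ saws (n - k) := by
    intro ω hω
    obtain ⟨hωh, hl⟩ := hF ω hω
    have hωs := hp_subset hωh
    obtain ⟨h0, -, -, -⟩ := mem_saws_iff.1 hωs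
    have hX := lastV_spec (n := n) h0
    rw [hl] at hX
    obtain ⟨hpa, hpv⟩ := prefixWalk_mem_arches2 hωh hk hX
    refine ⟨?_, hpa, twist_suffixWalk_mem hωs (by omega)⟩
    have e := visits_add_eq_left (k := k) (b := n - k) (ζ := ω)
      (fun j hj1 hjb => not_visit_of_lastV_lt (n := n) (ω := ω) (by omega) (by omega))
    rw [Nat.add_sub_cancel' (by omega : k ≤ n)] at e
    rw [hpv, e]
  have hinj : Set.InjOn g ↑F := by
    intro ω hω ω' hω' h
    simp only [hg, Prod.mk.injEq] at h
    obtain ⟨h1, h2⟩ := h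
    have hkk : ω k = ω' k := by simpa [Zd.prefixWalk] using congrFun h1 k
    have h3 : Zd.suffixWalk k (n - k) ω = Zd.suffixWalk k (n - k) ω' := by
      funext i
      have := congrFun h2 i
      rw [hkk] at this
      exact twistAt_injective _ this
    exact Zd.prefix_suffix_injOn (by omega) (saws_subset _ (hp_subset (hF ω hω).1))
      (saws_subset _ (hp_subset (hF ω' hω').1)) (Prod.ext h1 h3)
  calc ∑ ω ∈ F, y ^ visits n ω = ∑ ω ∈ F, y ^ visits k (g ω).1 :=
        Finset.sum_congr rfl fun ω hω => by rw [(hprops ω hω).1]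
    _ = ∑ p ∈ F.image g, y ^ visits k p.1 := by rw [Finset.sum_image hinj]
    _ ≤ ∑ p ∈ arches2 k ×ˢ saws (n - k), y ^ visits k p.1 := by
        refine Finset.sum_le_sum_of_subset_of_nonneg (fun p hp' => ?_) fun _ _ _ => pow_nonneg hy _
        obtain ⟨ω, hω, rfl⟩ := Finset.mem_image.1 hp'
        exact Finset.mem_product.2 ⟨(hprops ω hω).2.1, (hprops ω hω).2.2⟩
    _ = X2w k y * #(saws (n - k)) := by
        rw [Finset.sum_product, X2w, Finset.sum_mul]
        refine Finset.sum_congr rfl fun φ _ => ?_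
        dsimp only
        rw [Finset.sum_const, nsmul_eq_mul, mul_comm]

open Classical in
/-- **The long fibres `k ≤ m`** of the class-`A` arches of length `m+3`: weight `≤ y · X_k(y) · c_{m+2−k}(ℍ)` (alive prefix).
[cite: HammersleyTorrieWhittington1982, §2 (as summarised by Beaton 2014 arXiv v3 p. 11; locator provisional); MadrasSlade1993, §1.2, (1.2.3)] -/
theorem sum_fibA_le_X2 (m : ℕ) (hy : 0 ≤ y) {k : ℕ} (hk : k ≤ m) :
    ∑ ω ∈ fibA m k, y ^ visits (m + 3) ω ≤ y * (X2w k y * #(saws (m + 2 - k))) := by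
  set g : (ℕ → Site 2) → (ℕ → Site 2) := fun ω => Zd.prefixWalk (m + 2) ω with hg
  have hprops : ∀ ω ∈ fibA m k, g ω ∈ (hp (m + 2)).filter (fun ξ => lastV (m + 2) ξ = k) ∧
      visits (m + 3) ω = visits (m + 2) (g ω) + 1 := by
    intro ω hω
    obtain ⟨hωh, hend, -, -, -⟩ := fibA_anatomy hω
    obtain ⟨-, hkk⟩ := Finset.mem_filter.1 hω
    obtain ⟨hph, hpv⟩ := prefixWalk_mem_hp hωh (show m + 2 ≤ m + 3 by omega)
    refine ⟨Finset.mem_filter.2 ⟨hph, (lastV_prefixWalk _ _).trans hkk⟩, ?_⟩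
    rw [show m + 3 = m + 2 + 1 by omega, visits_succ, if_pos hend, hpv]
  have hinj : Set.InjOn g ↑(fibA m k) := by
    intro ω hω ω' hω' h
    rw [Finset.mem_coe] at hω hω'
    obtain ⟨hωh, hend, -, -, -⟩ := fibA_anatomy hω
    obtain ⟨hωh', hend', -, -, -⟩ := fibA_anatomy hω'
    have hωs := hp_subset hωh
    have hωs' := hp_subset hωh'
    have hagree : ∀ i ≤ m + 2, ω i = ω' i := fun i hi => by
      have := congrFun h i
      simpa [hg, Zd.prefixWalk, min_eq_left hi] using this
    refine eq_of_agree hωs hωs' fun i hi => ?_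
    rcases Nat.lt_or_ge i (m + 3) with hi' | hi'
    · exact hagree i (by omega)
    · have hin : i = m + 3 := le_antisymm hi hi'
      rw [hin]
      obtain ⟨-, -, hbw, -⟩ := mem_saws_iff.1 hωs
      obtain ⟨-, -, hbw', -⟩ := mem_saws_iff.1 hωs'
      have hst := hbw (m + 2) (by omega)
      have hst' := hbw' (m + 2) (by omega)
      rw [show m + 2 + 1 = m + 3 by omega] at hst hst'
      rw [hagree (m + 2) le_rfl] at hst
      exact wall_nbr_unique hst hst' hend hend'
  calc ∑ ω ∈ fibA m k, y ^ visits (m + 3) ω = ∑ ω ∈ fibA m k, y * y ^ visits (m + 2) (g ω) :=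
        Finset.sum_congr rfl fun ω hω => by rw [(hprops ω hω).2, pow_succ, mul_comm]
    _ = y * ∑ ξ ∈ (fibA m k).image g, y ^ visits (m + 2) ξ := by rw [Finset.mul_sum, Finset.sum_image hinj]
    _ ≤ y * ∑ ξ ∈ (hp (m + 2)).filter (fun ξ => lastV (m + 2) ξ = k), y ^ visits (m + 2) ξ := by
        refine mul_le_mul_of_nonneg_left ?_ hy
        refine Finset.sum_le_sum_of_subset_of_nonneg (fun ξ hξ => ?_) fun _ _ _ => pow_nonneg hy _
        obtain ⟨ω, hω, rfl⟩ := Finset.mem_image.1 hξ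
        exact (hprops ω hω).1
    _ ≤ y * (X2w k y * #(saws (m + 2 - k))) := mul_le_mul_of_nonneg_left (sum_fibre_lastV_le_X2 (n := m + 2) hy (by omega)) hy

/-! ### §4  The short fibres: connector (length 3), lengths 4 and 5 (empty), 6 (dead), 7 (two shapes) -/

open Classical in
/-- **The connector fibre `k = m` injects into the alive CLASS-`B` arches of length `m`** (`y ≥ 0`): weight `≤ y · b_m(y)`.  The prefix
is class `B` because the off-wall neighbour `(1, Y_m)` of `ω_m` is `ω_{m+1}`, so `ω_{m−1}` is the dimer partner (or `m = 0`); it is alive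
with witnesses `ω_{m+1}, ω_{m+2}`. [cite: EntingJensen2009, §7.4.2, Fig. 7.10; HammersleyTorrieWhittington1982, §2] -/
theorem sum_fibA_self_le_bW (m : ℕ) (hy : 0 ≤ y) : ∑ ω ∈ fibA m m, y ^ visits (m + 3) ω ≤ y * bW m y := by
  set g : (ℕ → Site 2) → (ℕ → Site 2) := fun ω => Zd.prefixWalk m ω with hg
  have hcoord : ∀ ω ∈ fibA m m, ω (m + 1) 0 = 1 ∧ ω (m + 1) 1 = ω m 1 ∧ ω (m + 2) 0 = 1 ∧
      ω (m + 2) 1 = ω m 1 + (if (1 + ω m 1) % 2 = 0 then 1 else -1) ∧ ω (m + 3) 0 = 0 ∧ ω (m + 3) 1 = ω (m + 2) 1 := by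
    intro ω hω
    obtain ⟨hωh, hend, -, hk0, hoff⟩ := fibA_anatomy hω
    obtain ⟨hωs, hH⟩ := mem_hp.1 hωh
    obtain ⟨-, -, hbw, -⟩ := mem_saws_iff.1 hωs
    have h1 := hoff (m + 1) (by omega) (by omega)
    have h2 := hoff (m + 2) (by omega) le_rfl
    have hX1 := hH (m + 1) (by omega)
    have hX2 := hH (m + 2) (by omega)
    have s0 := step_cases (hbw m (by omega))
    have s1 := step_cases (hbw (m + 1) (by omega))
    have s2 := step_cases (hbw (m + 2) (by omega))
    rw [show m + 1 + 1 = m + 2 by omega] at s1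
    rw [show m + 2 + 1 = m + 3 by omega] at s2
    refine ⟨by omega, by omega, by omega, ?_, hend, by omega⟩
    split_ifs with he <;> omega
  have hprops : ∀ ω ∈ fibA m m, g ω ∈ archesB2 m ∧ visits (m + 3) ω = visits m (g ω) + 1 := by
    intro ω hω
    obtain ⟨hωh, hend, -, hk0, hoff⟩ := fibA_anatomy hω
    obtain ⟨hωs, hH⟩ := mem_hp.1 hωh
    obtain ⟨-, -, hbw, hinj⟩ := mem_saws_iff.1 hωs
    obtain ⟨hpa2, hpv⟩ := prefixWalk_mem_arches2 hωh (show m + 2 ≤ m + 3 by omega) hk0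
    obtain ⟨hpa, hal⟩ := Finset.mem_filter.1 hpa2
    have hv : ∀ i ≤ m, g ω i = ω i := fun i hi => by simp [hg, Zd.prefixWalk, min_eq_left hi]
    obtain ⟨a0, a1, -, -, -, -⟩ := hcoord ω hω
    have hclassB : g ω (m - 1) 0 = 0 := by
      rw [hv (m - 1) (by omega)]
      rcases Nat.eq_zero_or_pos m with hm0 | hm0
      · subst hm0; exact hk0
      · have sp := step_cases (hbw (m - 1) (by omega))
        rw [show m - 1 + 1 = m by omega] at sp
        by_contra hne0
        have hXp : ω (m - 1) 0 = 1 ∧ ω (m - 1) 1 = ω m 1 := by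
          have := hH (m - 1) (by omega); constructor <;> omega
        have heq : ω (m - 1) = ω (m + 1) := (site_two_eq_iff _ _).2 ⟨by omega, by omega⟩
        have := hinj (show m - 1 ∈ {j | j ≤ m + 3} by simp only [Set.mem_setOf_eq]; omega)
          (show m + 1 ∈ {j | j ≤ m + 3} by simp only [Set.mem_setOf_eq]; omega) heq
        omega
    refine ⟨Finset.mem_filter.2 ⟨hpa, hclassB, hal⟩, ?_⟩
    have h1 := hoff (m + 1) (by omega) (by omega)
    have h2 := hoff (m + 2) (by omega) le_rfl
    rw [show m + 3 = m + 2 + 1 by omega, visits_succ, if_pos hend, show m + 2 = m + 1 + 1 by omega, visits_succ, if_neg h2,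
      visits_succ, if_neg h1, hpv]
  have hinj : Set.InjOn g ↑(fibA m m) := by
    intro ω hω ω' hω' h
    rw [Finset.mem_coe] at hω hω'
    have hc := hcoord ω hω
    have hc' := hcoord ω' hω'
    have hωs := hp_subset (fibA_anatomy hω).1
    have hωs' := hp_subset (fibA_anatomy hω').1
    have hagree : ∀ i ≤ m, ω i = ω' i := fun i hi => by
      have := congrFun h i
      simpa [hg, Zd.prefixWalk, min_eq_left hi] using this
    have hYm : ω m 1 = ω' m 1 := by rw [hagree m le_rfl]
    refine eq_of_agree hωs hωs' fun i hi => ?_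
    rcases Nat.lt_or_ge i (m + 1) with hi' | hi'
    · exact hagree i (by omega)
    · rw [site_two_eq_iff]
      obtain ⟨a0, a1, b0, b1, c0, c1⟩ := hc
      obtain ⟨a0', a1', b0', b1', c0', c1'⟩ := hc'
      rw [hYm] at a1 b1
      have hcase : i = m + 1 ∨ i = m + 2 ∨ i = m + 3 := by omega
      rcases hcase with rfl | rfl | rfl
      · exact ⟨by rw [a0, a0'], by rw [a1, a1']⟩
      · exact ⟨by rw [b0, b0'], by rw [b1, b1']⟩
      · exact ⟨by rw [c0, c0'], by rw [c1, c1', b1, b1']⟩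
  calc ∑ ω ∈ fibA m m, y ^ visits (m + 3) ω = ∑ ω ∈ fibA m m, y * y ^ visits m (g ω) :=
        Finset.sum_congr rfl fun ω hω => by rw [(hprops ω hω).2, pow_succ, mul_comm]
    _ = y * ∑ ξ ∈ (fibA m m).image g, y ^ visits m ξ := by rw [Finset.mul_sum, Finset.sum_image hinj]
    _ ≤ y * bW m y := by
        refine mul_le_mul_of_nonneg_left ?_ hy
        rw [bW]
        refine Finset.sum_le_sum_of_subset_of_nonneg (fun ξ hξ => ?_) fun _ _ _ => pow_nonneg hy _
        obtain ⟨ω, hω, rfl⟩ := Finset.mem_image.1 hξ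
        exact (hprops ω hω).1

open Classical in
/-- **No excursion of length four off the armchair wall**: `(0,Y) (1,Y) · (1,Y') (0,Y')` would need a second vertical bond at `(1,·)` or a
return through `(1,Y)`. [cite: EntingJensen2009, §7.4.2, Fig. 7.10] -/
theorem not_mem_fibA_four (k : ℕ) (ω : ℕ → Site 2) : ω ∉ fibA (k + 1) k := by
  intro hω
  obtain ⟨hωh, hend, -, hk0, hoff⟩ := fibA_anatomy hω
  rw [show k + 1 + 3 = k + 4 by omega] at hωh hend
  obtain ⟨hωs, hH⟩ := mem_hp.1 hωh
  obtain ⟨-, -, hbw, hinj⟩ := mem_saws_iff.1 hωs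
  have h1 := hoff (k + 1) (by omega) (by omega)
  have h2 := hoff (k + 2) (by omega) (by omega)
  have h3 := hoff (k + 3) (by omega) (by omega)
  have hX1 := hH (k + 1) (by omega)
  have s0 := step_cases (hbw k (by omega))
  have s1 := step_cases (hbw (k + 1) (by omega))
  rw [show k + 1 + 1 = k + 2 by omega] at s1
  have s2 := step_cases (hbw (k + 2) (by omega))
  rw [show k + 2 + 1 = k + 3 by omega] at s2
  have s3 := step_cases (hbw (k + 3) (by omega))
  rw [show k + 3 + 1 = k + 4 by omega] at s3
  have h13 : ¬ (ω (k + 3) 0 = ω (k + 1) 0 ∧ ω (k + 3) 1 = ω (k + 1) 1) := fun h => by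
    have := hinj (show k + 3 ∈ {j | j ≤ k + 4} by simp only [Set.mem_setOf_eq]; omega)
      (show k + 1 ∈ {j | j ≤ k + 4} by simp only [Set.mem_setOf_eq]; omega) ((site_two_eq_iff _ _).2 h)
    omega
  omega

open Classical in
/-- **No excursion of length five after the first step** (`k ≥ 1`): the only five-step excursion `(0,Y)(1,Y)(2,Y)(2,Y*)(1,Y*)(0,Y*)` lands on
the dimer PARTNER `(0,Y*)` of `(0,Y)`, which is `ω_{k−1}` (the prefix arrived along the dimer — it cannot have arrived from `(1,Y) = ω_{k+1}`).
[cite: EntingJensen2009, §7.4.2, Fig. 7.10] -/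
theorem not_mem_fibA_five {k : ℕ} (hk : 1 ≤ k) (ω : ℕ → Site 2) : ω ∉ fibA (k + 2) k := by
  intro hω
  obtain ⟨hωh, hend, -, hk0, hoff⟩ := fibA_anatomy hω
  rw [show k + 2 + 3 = k + 5 by omega] at hωh hend
  obtain ⟨hωs, hH⟩ := mem_hp.1 hωh
  obtain ⟨-, -, hbw, hinj⟩ := mem_saws_iff.1 hωs
  have hne : ∀ a b : ℕ, a ≤ k + 5 → b ≤ k + 5 → a ≠ b → ¬ (ω a 0 = ω b 0 ∧ ω a 1 = ω b 1) := by
    intro a b ha hb hab h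
    have := hinj (show a ∈ {i | i ≤ k + 5} by simp only [Set.mem_setOf_eq]; exact ha)
      (show b ∈ {i | i ≤ k + 5} by simp only [Set.mem_setOf_eq]; exact hb) ((site_two_eq_iff _ _).2 h)
    exact hab this
  have h1 := hoff (k + 1) (by omega) (by omega)
  have h2 := hoff (k + 2) (by omega) (by omega)
  have h3 := hoff (k + 3) (by omega) (by omega)
  have h4 := hoff (k + 4) (by omega) (by omega)
  have hX1 := hH (k + 1) (by omega)
  have hX2n := hH (k + 2) (by omega)
  have hX3n := hH (k + 3) (by omega)
  have hX4n := hH (k + 4) (by omega)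
  have hXm := hH (k - 1) (by omega)
  have hadj := hbw (k - 1) (by omega)
  rw [show k - 1 + 1 = k by omega] at hadj
  have sp := step_cases hadj
  have s0 := step_cases (hbw k (by omega))
  have s1 := step_cases (hbw (k + 1) (by omega))
  rw [show k + 1 + 1 = k + 2 by omega] at s1
  have s2 := step_cases (hbw (k + 2) (by omega))
  rw [show k + 2 + 1 = k + 3 by omega] at s2
  have s3 := step_cases (hbw (k + 3) (by omega))
  rw [show k + 3 + 1 = k + 4 by omega] at s3
  have s4 := step_cases (hbw (k + 4) (by omega))
  rw [show k + 4 + 1 = k + 5 by omega] at s4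
  have hX1' : ω (k + 1) 0 = 1 ∧ ω (k + 1) 1 = ω k 1 := by constructor <;> omega
  obtain ⟨hX1a, hX1b⟩ := hX1'
  -- the prefix arrived along the dimer: `ω (k−1)` is on the wall (else it would be `(1,Y) = ω (k+1)`)
  have hm1 := hne (k - 1) (k + 1) (by omega) (by omega) (by omega)
  have hP : ω (k - 1) 0 = 0 := by
    clear s1 s2 s3 s4
    by_contra hP
    exact hm1 ⟨by omega, by omega⟩
  have hPY : ω k 1 = ω (k - 1) 1 + (if ω (k - 1) 1 % 2 = 0 then 1 else -1) := wall_step_eq hadj hP hk0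
  clear sp hm1 hadj
  -- `ω (k+2) = (2, Y)`: the vertical alternative dies at `k+4`
  have h42 := hne (k + 4) (k + 2) (by omega) (by omega) (by omega)
  have h31 := hne (k + 3) (k + 1) (by omega) (by omega) (by omega)
  have hX4 : ω (k + 4) 0 = 1 := by clear s0 s1 s2 hPY; omega
  have hX2 : ω (k + 2) 0 = 2 ∧ ω (k + 2) 1 = ω k 1 := by
    clear s0 hPY
    constructor <;> omega
  obtain ⟨hX2a, hX2b⟩ := hX2
  -- `ω (k+3) = (2, Y*)`, `ω (k+4) = (1, Y*)`, `ω (k+5) = (0, Y*)` with `Y*` the partner level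
  have hX3 : ω (k + 3) 0 = 2 ∧ ω (k + 3) 1 = ω k 1 + (if (2 + ω k 1) % 2 = 0 then 1 else -1) := by
    clear s0 hPY s4
    constructor
    · omega
    · split_ifs with he <;> omega
  obtain ⟨hX3a, hX3b⟩ := hX3
  have hY4 : ω (k + 4) 1 = ω (k + 3) 1 := by clear s0 s1 hPY s4; omega
  have hY5 : ω (k + 5) 1 = ω (k + 4) 1 := by clear s0 s1 s2 hPY; omega
  -- hence `ω (k+5) = ω (k−1)`
  have h5m := hne (k + 5) (k - 1) (by omega) (by omega) (by omega)
  apply h5m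
  refine ⟨by rw [hend, hP], ?_⟩
  rw [hY5, hY4, hX3b]
  split_ifs at hPY with he
  · rw [if_neg (by omega)]; omega
  · rw [if_pos (by omega)]; omega

/-- **Context of an excursion launched at a wall visit `k ≥ 2`** of a class-`A` fibre: the launch vertex `ω_k = (0,Y)` was entered
ALONG the dimer from its partner `ω_{k−1} = (0, Y−τ)` (`τ = +1` if `Y−τ` is even, `−1` if odd), which in turn was entered from
`ω_{k−2} = (1, Y−τ)`; the excursion starts `ω_{k+1} = (1, Y)`.  (All forced: the off-wall neighbour of a wall vertex is unique, a wall
vertex has a unique wall neighbour.) [cite: EntingJensen2009, §7.4.2, Fig. 7.10] -/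
theorem launch_context {m k : ℕ} (hk : 2 ≤ k) (hkm : k + 1 ≤ m + 2) (hω : ω ∈ fibA m k) :
    ∃ τ : ℤ, (τ = 1 ∨ τ = -1) ∧ ω (k + 1) 0 = 1 ∧ ω (k + 1) 1 = ω k 1 ∧
      ω (k - 1) 0 = 0 ∧ ω (k - 1) 1 = ω k 1 - τ ∧ ω (k - 2) 0 = 1 ∧ ω (k - 2) 1 = ω k 1 - τ ∧
      ((ω k 1 - τ) % 2 = 0 ↔ τ = 1) := by
  obtain ⟨hωh, hend, -, hk0, hoff⟩ := fibA_anatomy hω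
  obtain ⟨hωs, hH⟩ := mem_hp.1 hωh
  obtain ⟨-, -, hbw, hinj⟩ := mem_saws_iff.1 hωs
  have hne : ∀ a b : ℕ, a ≤ m + 3 → b ≤ m + 3 → a ≠ b → ¬ (ω a 0 = ω b 0 ∧ ω a 1 = ω b 1) := by
    intro a b ha hb hab h
    have := hinj (show a ∈ {i | i ≤ m + 3} by simp only [Set.mem_setOf_eq]; exact ha)
      (show b ∈ {i | i ≤ m + 3} by simp only [Set.mem_setOf_eq]; exact hb) ((site_two_eq_iff _ _).2 h)
    exact hab this
  have h1 := hoff (k + 1) (by omega) (by omega)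
  have hX1 := hH (k + 1) (by omega)
  have hXm1 := hH (k - 1) (by omega)
  have hXm2 := hH (k - 2) (by omega)
  have s0 := step_cases (hbw k (by omega))
  have am1 := hbw (k - 1) (by omega)
  rw [show k - 1 + 1 = k by omega] at am1
  have sm1 := step_cases am1
  have am2 := hbw (k - 2) (by omega)
  rw [show k - 2 + 1 = k - 1 by omega] at am2
  have sm2 := step_cases am2
  have hX1' : ω (k + 1) 0 = 1 ∧ ω (k + 1) 1 = ω k 1 := by constructor <;> omega
  -- `ω (k−1)` is on the wall (else it is `(1,Y) = ω (k+1)`)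
  have hm11 := hne (k - 1) (k + 1) (by omega) (by omega) (by omega)
  have hP0 : ω (k - 1) 0 = 0 := by
    by_contra hP; exact hm11 ⟨by omega, by omega⟩
  have hPY := wall_step_eq am1 hP0 hk0
  -- `ω (k−2)` is off the wall (else it is the partner of `ω (k−1)`, i.e. `ω k`) and hence `(1, Y_{k−1})`
  have hm20 := hne (k - 2) k (by omega) (by omega) (by omega)
  have hQ : ω (k - 2) 0 = 1 ∧ ω (k - 2) 1 = ω (k - 1) 1 := by
    by_cases hq : ω (k - 2) 0 = 0
    · exfalso
      have e := wall_step_eq am2 hq hP0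
      apply hm20
      refine ⟨by omega, ?_⟩
      -- both `ω (k-2)` and `ω k` are the wall neighbour of `ω (k-1)`
      have e' := wall_step_eq am1.symm hk0 hP0
      split_ifs at e e' hPY <;> omega
    · constructor <;> omega
  refine ⟨ω k 1 - ω (k - 1) 1, ?_, hX1'.1, hX1'.2, hP0, by omega, hQ.1, by omega, ?_⟩
  · split_ifs at hPY <;> omega
  · split_ifs at hPY with he <;> constructor <;> intro h <;> omega

open Classical in
/-- **The excursion fibre of length six, first half** (`k ≥ 2`): two steps after the launch the walk is at `(1, Y+τ)` then `(2, Y+τ)`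
(the turn `(2,Y)` towards the partner side cannot be back at `X = 1` by time `k+5`), and `X_{k+5} = 1`.
[cite: EntingJensen2009, §7.4.2, Fig. 7.10] -/
theorem fibA_six_head {k : ℕ} (hk : 2 ≤ k) (hω : ω ∈ fibA (k + 3) k) :
    ∃ τ : ℤ, (τ = 1 ∨ τ = -1) ∧ ((ω k 1 - τ) % 2 = 0 ↔ τ = 1) ∧ (ω (k - 2) 0 = 1 ∧ ω (k - 2) 1 = ω k 1 - τ) ∧
      (ω (k + 2) 0 = 1 ∧ ω (k + 2) 1 = ω k 1 + τ) ∧ (ω (k + 3) 0 = 2 ∧ ω (k + 3) 1 = ω k 1 + τ) ∧ ω (k + 5) 0 = 1 := by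
  obtain ⟨τ, hτ, hX1, hY1, hP0, hPY, hQ0, hQY, hpar⟩ := launch_context hk (by omega) hω
  obtain ⟨hωh, hend, -, hk0, hoff⟩ := fibA_anatomy hω
  rw [show k + 3 + 3 = k + 6 by omega] at hωh hend
  obtain ⟨hωs, hH⟩ := mem_hp.1 hωh
  obtain ⟨-, -, hbw, hinj⟩ := mem_saws_iff.1 hωs
  have hne : ∀ a b : ℕ, a ≤ k + 6 → b ≤ k + 6 → a ≠ b → ¬ (ω a 0 = ω b 0 ∧ ω a 1 = ω b 1) := by
    intro a b ha hb hab h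
    have := hinj (show a ∈ {i | i ≤ k + 6} by simp only [Set.mem_setOf_eq]; exact ha)
      (show b ∈ {i | i ≤ k + 6} by simp only [Set.mem_setOf_eq]; exact hb) ((site_two_eq_iff _ _).2 h)
    exact hab this
  have h2 := hoff (k + 2) (by omega) (by omega)
  have h3 := hoff (k + 3) (by omega) (by omega)
  have h5 := hoff (k + 5) (by omega) (by omega)
  have hX5n := hH (k + 5) (by omega)
  have s1 := step_cases (hbw (k + 1) (by omega))
  rw [show k + 1 + 1 = k + 2 by omega] at s1
  have s2 := step_cases (hbw (k + 2) (by omega))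
  rw [show k + 2 + 1 = k + 3 by omega] at s2
  have s3 := step_cases (hbw (k + 3) (by omega))
  rw [show k + 3 + 1 = k + 4 by omega] at s3
  have s4 := step_cases (hbw (k + 4) (by omega))
  rw [show k + 4 + 1 = k + 5 by omega] at s4
  have s5 := step_cases (hbw (k + 5) (by omega))
  rw [show k + 5 + 1 = k + 6 by omega] at s5
  have h31 := hne (k + 3) (k + 1) (by omega) (by omega) (by omega)
  have h42 := hne (k + 4) (k + 2) (by omega) (by omega) (by omega)
  have h4m2 := hne (k + 4) (k - 2) (by omega) (by omega) (by omega)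
  -- `ω (k+5) = (1, ·)` (A-arrival)
  have hX5 : ω (k + 5) 0 = 1 := by clear s1 s2 s3 s4 h31 h42 h4m2; omega
  clear s5
  -- step `k+2`: `(2,Y)` or the vertical `(1,Y+τ)`
  have hA : (ω (k + 2) 0 = 2 ∧ ω (k + 2) 1 = ω k 1) ∨ (ω (k + 2) 0 = 1 ∧ ω (k + 2) 1 = ω k 1 + τ) := by
    clear s2 s3 s4 h31 h42 h4m2 hX5
    rcases hτ with hτ | hτ <;> (subst hτ; omega)
  clear s1
  -- the `(2,Y)` branch cannot be back at `X = 1` by time `k+5`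
  have hnot2 : ¬ (ω (k + 2) 0 = 2 ∧ ω (k + 2) 1 = ω k 1) := by
    rintro ⟨hx, hy'⟩
    clear hA
    have hB : (ω (k + 3) 0 = 3 ∧ ω (k + 3) 1 = ω k 1) ∨ (ω (k + 3) 0 = 2 ∧ ω (k + 3) 1 = ω k 1 - τ) := by
      clear s3 s4 h42 h4m2 hX5
      rcases hτ with hτ | hτ <;> (subst hτ; omega)
    clear s2 h31
    have hC : ω (k + 4) 0 = 4 ∨ ω (k + 4) 0 = 3 := by
      clear s4 hX5
      rcases hB with ⟨hB1, hB2⟩ | ⟨hB1, hB2⟩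
      · clear h4m2 hpar hPY hQY; omega
      · rcases hτ with hτ | hτ <;> (subst hτ; omega)
    clear s3 hB h42 h4m2 hpar
    omega
  have hX2 : ω (k + 2) 0 = 1 ∧ ω (k + 2) 1 = ω k 1 + τ := hA.resolve_left hnot2
  obtain ⟨hX2a, hY2⟩ := hX2
  clear hA hnot2
  have hX3 : ω (k + 3) 0 = 2 ∧ ω (k + 3) 1 = ω k 1 + τ := by
    clear s3 s4 h42 h4m2 hX5
    rcases hτ with hτ | hτ <;> (subst hτ; constructor <;> omega)
  exact ⟨τ, hτ, hpar, ⟨hQ0, hQY⟩, ⟨hX2a, hY2⟩, hX3, hX5⟩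

open Classical in
/-- **The excursion fibre of length six, second half**: it is the «skip-and-return» `(1,Y)(1,Y+τ)(2,Y+τ)(2,Y+2τ)(1,Y+2τ)(0,Y+2τ)`.
[cite: EntingJensen2009, §7.4.2, Fig. 7.10] -/
theorem fibA_six_coords {k : ℕ} (hk : 2 ≤ k) (hω : ω ∈ fibA (k + 3) k) :
    ∃ τ : ℤ, (τ = 1 ∨ τ = -1) ∧ ((ω k 1 - τ) % 2 = 0 ↔ τ = 1) ∧ (ω (k + 2) 0 = 1 ∧ ω (k + 2) 1 = ω k 1 + τ) ∧
      (ω (k + 5) 0 = 1 ∧ ω (k + 5) 1 = ω k 1 + 2 * τ) ∧ (ω (k + 6) 0 = 0 ∧ ω (k + 6) 1 = ω k 1 + 2 * τ) := by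
  obtain ⟨τ, hτ, hpar, ⟨hQ0, hQY⟩, ⟨hX2a, hY2⟩, ⟨hX3a, hY3⟩, hX5⟩ := fibA_six_head hk hω
  obtain ⟨hωh, hend, -, hk0, hoff⟩ := fibA_anatomy hω
  rw [show k + 3 + 3 = k + 6 by omega] at hωh hend
  obtain ⟨hωs, hH⟩ := mem_hp.1 hωh
  obtain ⟨-, -, hbw, hinj⟩ := mem_saws_iff.1 hωs
  have hne : ∀ a b : ℕ, a ≤ k + 6 → b ≤ k + 6 → a ≠ b → ¬ (ω a 0 = ω b 0 ∧ ω a 1 = ω b 1) := by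
    intro a b ha hb hab h
    have := hinj (show a ∈ {i | i ≤ k + 6} by simp only [Set.mem_setOf_eq]; exact ha)
      (show b ∈ {i | i ≤ k + 6} by simp only [Set.mem_setOf_eq]; exact hb) ((site_two_eq_iff _ _).2 h)
    exact hab this
  have s3 := step_cases (hbw (k + 3) (by omega))
  rw [show k + 3 + 1 = k + 4 by omega] at s3
  have s4 := step_cases (hbw (k + 4) (by omega))
  rw [show k + 4 + 1 = k + 5 by omega] at s4
  have s5 := step_cases (hbw (k + 5) (by omega))
  rw [show k + 5 + 1 = k + 6 by omega] at s5
  have h42 := hne (k + 4) (k + 2) (by omega) (by omega) (by omega)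
  have hno3 : ω (k + 4) 0 ≠ 3 := by
    intro h4x
    clear s3 s5 h42
    omega
  have hX4 : ω (k + 4) 0 = 2 ∧ ω (k + 4) 1 = ω k 1 + 2 * τ := by
    clear s4 s5 hX5
    rcases hτ with hτ | hτ <;> (subst hτ; constructor <;> omega)
  obtain ⟨hX4a, hY4⟩ := hX4
  clear s3 h42 hno3
  have hY5 : ω (k + 5) 1 = ω k 1 + 2 * τ := by clear s5; omega
  have hY6 : ω (k + 6) 1 = ω k 1 + 2 * τ := by clear s4; omega
  exact ⟨τ, hτ, hpar, ⟨hX2a, hY2⟩, ⟨hX5, hY5⟩, hend, hY6⟩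

open Classical in
/-- **The excursion fibre of length six is NOT two-step alive** (`k ≥ 2`): its end `(0,Y+2τ)` admits the single fresh neighbour `(0,Y+τ)`
(the skipped wall vertex), whose own neighbours `(1,Y+τ) = ω_{k+2}` and `(0,Y+2τ) = ω_{k+6}` are used.
[cite: EntingJensen2009, §7.4.2, Fig. 7.10; HammersleyTorrieWhittington1982, §2] -/
theorem not_alive_of_mem_fibA_six {k : ℕ} (hk : 2 ≤ k) (hω : ω ∈ fibA (k + 3) k) : ¬ Alive2 (k + 6) ω := by
  obtain ⟨τ, hτ, hpar, ⟨hX2a, hY2⟩, ⟨hX5, hY5⟩, ⟨hend, hY6⟩⟩ := fibA_six_coords hk hω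
  rintro ⟨z₁, z₂, hz1, hz2, hz1n, hz2n, hfresh⟩
  rw [brickWallGraph_adj_coord] at hz1 hz2
  obtain ⟨f5a, -⟩ := hfresh (k + 5) (by omega)
  obtain ⟨-, f2b⟩ := hfresh (k + 2) (by omega)
  obtain ⟨-, f6b⟩ := hfresh (k + 6) le_rfl
  have a5 : ¬ (ω (k + 5) 0 = z₁ 0 ∧ ω (k + 5) 1 = z₁ 1) := fun h => f5a ((site_two_eq_iff _ _).2 h)
  have b2 : ¬ (ω (k + 2) 0 = z₂ 0 ∧ ω (k + 2) 1 = z₂ 1) := fun h => f2b ((site_two_eq_iff _ _).2 h)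
  have b6 : ¬ (ω (k + 6) 0 = z₂ 0 ∧ ω (k + 6) 1 = z₂ 1) := fun h => f6b ((site_two_eq_iff _ _).2 h)
  have hz1c : z₁ 0 = 0 ∧ z₁ 1 = ω k 1 + τ := by
    clear hz2 b2 b6 hz2n
    rcases hτ with hτ | hτ <;> (subst hτ; constructor <;> omega)
  obtain ⟨hz1x, hz1y⟩ := hz1c
  clear hz1 a5
  rcases hτ with hτ | hτ <;> (subst hτ; omega)

set_option maxHeartbeats 400000 in
open Classical in
/-- **The excursion fibre of length seven, first half** (`k ≥ 2`): after the launch the walk follows either the «skip a dimer» branch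
`(1,Y+τ)(2,Y+τ)(2,Y+2τ)` or the «wide connector» branch `(2,Y)(3,Y)(3,Y+τ)` (every other choice cannot be back at `X = 1` by time `k+6`,
or meets `ω_{k−2} = (1,Y−τ)`). [cite: EntingJensen2009, §7.4.2, Fig. 7.10] -/
theorem fibA_seven_head {k : ℕ} (hk : 2 ≤ k) (hω : ω ∈ fibA (k + 4) k) :
    ∃ τ : ℤ, (τ = 1 ∨ τ = -1) ∧ ((ω k 1 - τ) % 2 = 0 ↔ τ = 1) ∧ (ω (k - 1) 0 = 0 ∧ ω (k - 2) 0 = 1 ∧ ω (k - 2) 1 = ω k 1 - τ) ∧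
      ω (k + 6) 0 = 1 ∧
      ((ω (k + 2) 0 = 1 ∧ ω (k + 2) 1 = ω k 1 + τ ∧ ω (k + 3) 0 = 2 ∧ ω (k + 3) 1 = ω k 1 + τ ∧
          ω (k + 4) 0 = 2 ∧ ω (k + 4) 1 = ω k 1 + 2 * τ) ∨
        (ω (k + 2) 0 = 2 ∧ ω (k + 2) 1 = ω k 1 ∧ ω (k + 3) 0 = 3 ∧ ω (k + 3) 1 = ω k 1 ∧
          ω (k + 4) 0 = 3 ∧ ω (k + 4) 1 = ω k 1 + τ)) := by
  obtain ⟨τ, hτ, hX1, hY1, hP0, hPY, hQ0, hQY, hpar⟩ := launch_context hk (by omega) hω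
  obtain ⟨hωh, hend, -, hk0, hoff⟩ := fibA_anatomy hω
  rw [show k + 4 + 3 = k + 7 by omega] at hωh hend
  obtain ⟨hωs, hH⟩ := mem_hp.1 hωh
  obtain ⟨-, -, hbw, hinj⟩ := mem_saws_iff.1 hωs
  have hne : ∀ a b : ℕ, a ≤ k + 7 → b ≤ k + 7 → a ≠ b → ¬ (ω a 0 = ω b 0 ∧ ω a 1 = ω b 1) := by
    intro a b ha hb hab h
    have := hinj (show a ∈ {i | i ≤ k + 7} by simp only [Set.mem_setOf_eq]; exact ha)
      (show b ∈ {i | i ≤ k + 7} by simp only [Set.mem_setOf_eq]; exact hb) ((site_two_eq_iff _ _).2 h)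
    exact hab this
  have h2 := hoff (k + 2) (by omega) (by omega)
  have h3 := hoff (k + 3) (by omega) (by omega)
  have h4 := hoff (k + 4) (by omega) (by omega)
  have h6 := hoff (k + 6) (by omega) (by omega)
  have hX6n := hH (k + 6) (by omega)
  have s1 := step_cases (hbw (k + 1) (by omega))
  rw [show k + 1 + 1 = k + 2 by omega] at s1
  have s2 := step_cases (hbw (k + 2) (by omega))
  rw [show k + 2 + 1 = k + 3 by omega] at s2
  have s3 := step_cases (hbw (k + 3) (by omega))
  rw [show k + 3 + 1 = k + 4 by omega] at s3
  have s4 := step_cases (hbw (k + 4) (by omega))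
  rw [show k + 4 + 1 = k + 5 by omega] at s4
  have s5 := step_cases (hbw (k + 5) (by omega))
  rw [show k + 5 + 1 = k + 6 by omega] at s5
  have s6 := step_cases (hbw (k + 6) (by omega))
  rw [show k + 6 + 1 = k + 7 by omega] at s6
  have h31 := hne (k + 3) (k + 1) (by omega) (by omega) (by omega)
  have h42 := hne (k + 4) (k + 2) (by omega) (by omega) (by omega)
  have h4m2 := hne (k + 4) (k - 2) (by omega) (by omega) (by omega)
  have h53 := hne (k + 5) (k + 3) (by omega) (by omega) (by omega)
  -- `X_{k+6} = 1` (A-arrival at `k+7`)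
  have hX6 : ω (k + 6) 0 = 1 := by clear s1 s2 s3 s4 s5 h31 h42 h4m2 h53; omega
  clear s6
  -- step `k+2`
  have hA : (ω (k + 2) 0 = 2 ∧ ω (k + 2) 1 = ω k 1) ∨ (ω (k + 2) 0 = 1 ∧ ω (k + 2) 1 = ω k 1 + τ) := by
    clear s2 s3 s4 s5 h31 h42 h4m2 h53 hX6
    rcases hτ with hτ | hτ <;> (subst hτ; omega)
  clear s1
  rcases hA with ⟨hX2, hY2⟩ | ⟨hX2, hY2⟩
  · -- the wide-connector branch: `(2,Y) (3,Y) (3,Y+τ)`; the turn `(2,Y−τ)` dies at `(1,Y−τ) = ω (k−2)` or cannot return in time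
    have hB : (ω (k + 3) 0 = 3 ∧ ω (k + 3) 1 = ω k 1) ∨ (ω (k + 3) 0 = 2 ∧ ω (k + 3) 1 = ω k 1 - τ) := by
      clear s3 s4 s5 h42 h4m2 h53 hX6
      rcases hτ with hτ | hτ <;> (subst hτ; omega)
    clear s2 h31
    have hnotB : ¬ (ω (k + 3) 0 = 2 ∧ ω (k + 3) 1 = ω k 1 - τ) := by
      rintro ⟨bx, by'⟩
      clear hB
      have hC : ω (k + 4) 0 = 3 ∧ ω (k + 4) 1 = ω k 1 - τ := by
        clear s4 s5 h53 hX6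
        rcases hτ with hτ | hτ <;> (subst hτ; constructor <;> omega)
      clear s3 h42 h4m2
      have hD : ω (k + 5) 0 = 4 ∨ ω (k + 5) 0 = 3 := by clear s5 hX6 hpar hPY hQY; omega
      clear s4 h53 hpar hPY hQY
      omega
    have hX3 : ω (k + 3) 0 = 3 ∧ ω (k + 3) 1 = ω k 1 := hB.resolve_right hnotB
    obtain ⟨hX3a, hY3⟩ := hX3
    clear hB hnotB h4m2
    have hC : ω (k + 4) 0 = 4 ∨ (ω (k + 4) 0 = 3 ∧ ω (k + 4) 1 = ω k 1 + τ) := by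
      clear s4 s5 h53 hX6
      rcases hτ with hτ | hτ <;> (subst hτ; omega)
    clear s3 h42
    have hnot4 : ω (k + 4) 0 ≠ 4 := by
      intro c4
      clear hC
      have hD : ω (k + 5) 0 = 5 ∨ ω (k + 5) 0 = 3 ∨ ω (k + 5) 0 = 4 := by clear s5 hX6 hpar hPY hQY h53; omega
      clear s4 h53 hpar hPY hQY
      omega
    have hX4 := hC.resolve_left hnot4
    exact ⟨τ, hτ, hpar, ⟨hP0, hQ0, hQY⟩, hX6, Or.inr ⟨hX2, hY2, hX3a, hY3, hX4.1, hX4.2⟩⟩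
  · -- the skip-a-dimer branch: `(1,Y+τ) (2,Y+τ) (2,Y+2τ)`; `(3,Y+τ)` cannot return in time
    have hX3 : ω (k + 3) 0 = 2 ∧ ω (k + 3) 1 = ω k 1 + τ := by
      clear s3 s4 s5 h42 h4m2 h53 hX6
      rcases hτ with hτ | hτ <;> (subst hτ; constructor <;> omega)
    obtain ⟨hX3a, hY3⟩ := hX3
    clear s2 h31 h4m2
    have hC : (ω (k + 4) 0 = 3 ∧ ω (k + 4) 1 = ω k 1 + τ) ∨ (ω (k + 4) 0 = 2 ∧ ω (k + 4) 1 = ω k 1 + 2 * τ) := by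
      clear s4 s5 h53 hX6
      rcases hτ with hτ | hτ <;> (subst hτ; omega)
    clear s3 h42
    have hnot3 : ¬ (ω (k + 4) 0 = 3 ∧ ω (k + 4) 1 = ω k 1 + τ) := by
      rintro ⟨c3, c3'⟩
      clear hC
      have hD : ω (k + 5) 0 = 4 ∨ ω (k + 5) 0 = 3 := by clear s5 hX6 hpar hPY hQY; omega
      clear s4 hpar hPY hQY h53
      omega
    have hX4 := hC.resolve_left hnot3
    exact ⟨τ, hτ, hpar, ⟨hP0, hQ0, hQY⟩, hX6, Or.inl ⟨hX2, hY2, hX3a, hY3, hX4.1, hX4.2⟩⟩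

open Classical in
/-- **The excursion fibre of length seven: exactly two shapes** (`k ≥ 2`) — «skip a dimer»
`(1,Y)(1,Y+τ)(2,Y+τ)(2,Y+2τ)(1,Y+2τ)(1,Y+3τ)(0,Y+3τ)` or the «wide connector» `(1,Y)(2,Y)(3,Y)(3,Y+τ)(2,Y+τ)(1,Y+τ)(0,Y+τ)`,
distinguished by `X_{k+2} ∈ {1, 2}`. [cite: EntingJensen2009, §7.4.2, Fig. 7.10; Beaton2014RotatedHoneycomb, §3.1 (arXiv v3 p. 12: unfolded walks on the honeycomb lattice)] -/
theorem fibA_seven_coords {k : ℕ} (hk : 2 ≤ k) (hω : ω ∈ fibA (k + 4) k) :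
    ∃ τ : ℤ, (τ = 1 ∨ τ = -1) ∧ ω (k - 1) 0 = 0 ∧
      ((ω (k + 2) 0 = 1 ∧ ω (k + 2) 1 = ω k 1 + τ ∧ ω (k + 3) 0 = 2 ∧ ω (k + 3) 1 = ω k 1 + τ ∧
          ω (k + 4) 0 = 2 ∧ ω (k + 4) 1 = ω k 1 + 2 * τ ∧ ω (k + 5) 0 = 1 ∧ ω (k + 5) 1 = ω k 1 + 2 * τ ∧
          ω (k + 6) 0 = 1 ∧ ω (k + 6) 1 = ω k 1 + 3 * τ ∧ ω (k + 7) 0 = 0 ∧ ω (k + 7) 1 = ω k 1 + 3 * τ) ∨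
        (ω (k + 2) 0 = 2 ∧ ω (k + 2) 1 = ω k 1 ∧ ω (k + 3) 0 = 3 ∧ ω (k + 3) 1 = ω k 1 ∧
          ω (k + 4) 0 = 3 ∧ ω (k + 4) 1 = ω k 1 + τ ∧ ω (k + 5) 0 = 2 ∧ ω (k + 5) 1 = ω k 1 + τ ∧
          ω (k + 6) 0 = 1 ∧ ω (k + 6) 1 = ω k 1 + τ ∧ ω (k + 7) 0 = 0 ∧ ω (k + 7) 1 = ω k 1 + τ)) := by
  obtain ⟨τ, hτ, hpar, ⟨hP0, hQ0, hQY⟩, hX6, hbr⟩ := fibA_seven_head hk hω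
  obtain ⟨hωh, hend, -, hk0, hoff⟩ := fibA_anatomy hω
  rw [show k + 4 + 3 = k + 7 by omega] at hωh hend
  obtain ⟨hωs, hH⟩ := mem_hp.1 hωh
  obtain ⟨-, -, hbw, hinj⟩ := mem_saws_iff.1 hωs
  have hne : ∀ a b : ℕ, a ≤ k + 7 → b ≤ k + 7 → a ≠ b → ¬ (ω a 0 = ω b 0 ∧ ω a 1 = ω b 1) := by
    intro a b ha hb hab h
    have := hinj (show a ∈ {i | i ≤ k + 7} by simp only [Set.mem_setOf_eq]; exact ha)
      (show b ∈ {i | i ≤ k + 7} by simp only [Set.mem_setOf_eq]; exact hb) ((site_two_eq_iff _ _).2 h)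
    exact hab this
  have h5 := hoff (k + 5) (by omega) (by omega)
  have h6 := hoff (k + 6) (by omega) (by omega)
  have s4 := step_cases (hbw (k + 4) (by omega))
  rw [show k + 4 + 1 = k + 5 by omega] at s4
  have s5 := step_cases (hbw (k + 5) (by omega))
  rw [show k + 5 + 1 = k + 6 by omega] at s5
  have s6 := step_cases (hbw (k + 6) (by omega))
  rw [show k + 6 + 1 = k + 7 by omega] at s6
  have h53 := hne (k + 5) (k + 3) (by omega) (by omega) (by omega)
  have h64 := hne (k + 6) (k + 4) (by omega) (by omega) (by omega)
  refine ⟨τ, hτ, hP0, ?_⟩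
  rcases hbr with ⟨hX2, hY2, hX3, hY3, hX4, hY4⟩ | ⟨hX2, hY2, hX3, hY3, hX4, hY4⟩
  · left
    -- `(2,Y+2τ) → (1,Y+2τ) → (1,Y+3τ) → (0,Y+3τ)` (`(3,Y+2τ)` cannot return; the last vertical is the fresh bond at `(1,Y+2τ)`)
    have hX5 : ω (k + 5) 0 = 1 ∧ ω (k + 5) 1 = ω k 1 + 2 * τ := by
      have hno3 : ω (k + 5) 0 ≠ 3 := by intro c; clear s4 h53 h64 hpar; omega
      clear s5 s6 h64
      rcases hτ with hτ | hτ <;> (subst hτ; constructor <;> omega)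
    obtain ⟨hX5a, hY5⟩ := hX5
    clear s4 h53
    have hY6 : ω (k + 6) 1 = ω k 1 + 3 * τ := by
      clear s6
      rcases hτ with hτ | hτ <;> (subst hτ; omega)
    clear s5 h64
    have hY7 : ω (k + 7) 1 = ω (k + 6) 1 := by omega
    exact ⟨hX2, hY2, hX3, hY3, hX4, hY4, hX5a, hY5, hX6, hY6, hend, by rw [hY7, hY6]⟩
  · right
    -- `(3,Y+τ) → (2,Y+τ) → (1,Y+τ) → (0,Y+τ)`
    have hX5 : ω (k + 5) 0 = 2 ∧ ω (k + 5) 1 = ω k 1 + τ := by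
      have hno4 : ω (k + 5) 0 ≠ 4 := by intro c; clear s4 h53 h64 hpar; omega
      clear s5 s6 h64
      rcases hτ with hτ | hτ <;> (subst hτ; constructor <;> omega)
    obtain ⟨hX5a, hY5⟩ := hX5
    clear s4 h53
    have hY6 : ω (k + 6) 1 = ω k 1 + τ := by
      clear s6
      rcases hτ with hτ | hτ <;> (subst hτ; omega)
    clear s5 h64
    have hY7 : ω (k + 7) 1 = ω (k + 6) 1 := by omega
    exact ⟨hX2, hY2, hX3, hY3, hX4, hY4, hX5a, hY5, hX6, hY6, hend, by rw [hY7, hY6]⟩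

open Classical in
/-- The length-seven fibre in PREFIX coordinates: with `T = Y_k − Y_{k−1}` (`= τ`), every vertex `ω_{k+1}, …, ω_{k+7}` is an explicit
function of `Y_k`, `Y_{k−1}` and the shape bit `X_{k+2} ∈ {1,2}`. [cite: EntingJensen2009, §7.4.2, Fig. 7.10] -/
theorem fibA_seven_coords₂ {k : ℕ} (hk : 2 ≤ k) (hω : ω ∈ fibA (k + 4) k) :
    ω (k - 1) 0 = 0 ∧ (ω (k + 1) 0 = 1 ∧ ω (k + 1) 1 = ω k 1) ∧
      ((ω (k + 2) 0 = 1 ∧ ω (k + 2) 1 = 2 * ω k 1 - ω (k - 1) 1 ∧ ω (k + 3) 0 = 2 ∧ ω (k + 3) 1 = 2 * ω k 1 - ω (k - 1) 1 ∧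
          ω (k + 4) 0 = 2 ∧ ω (k + 4) 1 = 3 * ω k 1 - 2 * ω (k - 1) 1 ∧ ω (k + 5) 0 = 1 ∧ ω (k + 5) 1 = 3 * ω k 1 - 2 * ω (k - 1) 1 ∧
          ω (k + 6) 0 = 1 ∧ ω (k + 6) 1 = 4 * ω k 1 - 3 * ω (k - 1) 1 ∧ ω (k + 7) 0 = 0 ∧ ω (k + 7) 1 = 4 * ω k 1 - 3 * ω (k - 1) 1) ∨
        (ω (k + 2) 0 = 2 ∧ ω (k + 2) 1 = ω k 1 ∧ ω (k + 3) 0 = 3 ∧ ω (k + 3) 1 = ω k 1 ∧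
          ω (k + 4) 0 = 3 ∧ ω (k + 4) 1 = 2 * ω k 1 - ω (k - 1) 1 ∧ ω (k + 5) 0 = 2 ∧ ω (k + 5) 1 = 2 * ω k 1 - ω (k - 1) 1 ∧
          ω (k + 6) 0 = 1 ∧ ω (k + 6) 1 = 2 * ω k 1 - ω (k - 1) 1 ∧ ω (k + 7) 0 = 0 ∧ ω (k + 7) 1 = 2 * ω k 1 - ω (k - 1) 1)) := by
  obtain ⟨τ, hτ, hX1, hY1, hP0, hPY, -, -, -⟩ := launch_context hk (show k + 1 ≤ k + 4 + 2 by omega) hω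
  obtain ⟨τ', hτ', -, hc⟩ := fibA_seven_coords hk hω
  refine ⟨hP0, ⟨hX1, hY1⟩, ?_⟩
  -- `τ' = τ = Y_k − Y_{k−1}`: compare the second coordinate of `ω (k+2)` … no: read `τ'` from `ω (k+4)` vs parity?  Simpler: both are
  -- `±1` and `ω (k+2)`/`ω (k+4)` pin `τ'` against `τ` through the vertical bond at `(1, Y_k)` resp. `(3, Y_k)`; we avoid this by
  -- recomputing: in the skip branch `Y_{k+2} = Y_k + τ'` is the vertical partner level of `(1, Y_k)`, i.e. `τ' = 1 ↔ (1 + Y_k)` even,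
  -- while `τ = 1 ↔ (Y_k − τ)` even ↔ `Y_{k−1}` even; and `Y_k = Y_{k−1} + (±1)` flips parity — so `τ' = τ`.
  obtain ⟨hωh, -, -, hk0, hoff⟩ := fibA_anatomy hω
  obtain ⟨hωs, hH⟩ := mem_hp.1 hωh
  obtain ⟨-, -, hbw, -⟩ := mem_saws_iff.1 hωs
  have s1 := step_cases (hbw (k + 1) (by omega))
  rw [show k + 1 + 1 = k + 2 by omega] at s1
  have s3 := step_cases (hbw (k + 3) (by omega))
  rw [show k + 3 + 1 = k + 4 by omega] at s3
  have am1 := hbw (k - 1) (by omega)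
  rw [show k - 1 + 1 = k by omega] at am1
  have sm1 := step_cases am1
  rcases hc with ⟨a0, a1, b0, b1, c0, c1, d0, d1, e0, e1, f0, f1⟩ | ⟨a0, a1, b0, b1, c0, c1, d0, d1, e0, e1, f0, f1⟩
  · left
    have hττ : τ' = τ := by
      clear s3 b0 b1 c0 c1 d0 d1 e0 e1 f0 f1
      rcases hτ with h | h <;> rcases hτ' with h' | h' <;> subst h <;> subst h' <;> omega
    subst hττ
    refine ⟨a0, by omega, b0, by omega, c0, by omega, d0, by omega, e0, by omega, f0, by omega⟩
  · right
    have hττ : τ' = τ := by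
      clear s1 d0 d1 e0 e1 f0 f1
      rcases hτ with h | h <;> rcases hτ' with h' | h' <;> subst h <;> subst h' <;> omega
    subst hττ
    refine ⟨a0, a1, b0, b1, c0, by omega, d0, by omega, e0, by omega, f0, by omega⟩

open Classical in
/-- **The fibre of excursion length seven weighs at most `2y · b_k(y)`** (`k ≥ 2`, `y ≥ 0`): the map `ω ↦ (ω|[0,k], [X_{k+2} = 1])` is
injective (`fibA_seven_coords₂`), the prefix is an alive CLASS-`B` arch (`ω_{k−1}` on the wall; witnesses `ω_{k+1}, ω_{k+2}`), and the
excursion adds one visit. [cite: HammersleyTorrieWhittington1982, §2 (as summarised by Beaton 2014 arXiv v3 p. 11; locator provisional); EntingJensen2009, §7.4.2, Fig. 7.10] -/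
theorem sum_fibA_seven_le {k : ℕ} (hk : 2 ≤ k) (hy : 0 ≤ y) :
    ∑ ω ∈ fibA (k + 4) k, y ^ visits (k + 7) ω ≤ 2 * y * bW k y := by
  set g : (ℕ → Site 2) → (ℕ → Site 2) × Bool := fun ω => (Zd.prefixWalk k ω, decide (ω (k + 2) 0 = 1)) with hg
  have hprops : ∀ ω ∈ fibA (k + 4) k, Zd.prefixWalk k ω ∈ archesB2 k ∧ visits (k + 7) ω = visits k (Zd.prefixWalk k ω) + 1 := by
    intro ω hω
    obtain ⟨hP0, -, -⟩ := fibA_seven_coords₂ hk hω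
    obtain ⟨hωh, hend, -, hk0, hoff⟩ := fibA_anatomy hω
    rw [show k + 4 + 3 = k + 7 by omega] at hωh hend
    obtain ⟨hpa2, hpv⟩ := prefixWalk_mem_arches2 hωh (show k + 2 ≤ k + 7 by omega) hk0
    obtain ⟨hpa, hal⟩ := Finset.mem_filter.1 hpa2
    have hv : ∀ i ≤ k, Zd.prefixWalk k ω i = ω i := fun i hi => by simp [Zd.prefixWalk, min_eq_left hi]
    refine ⟨Finset.mem_filter.2 ⟨hpa, by rw [hv (k - 1) (by omega)]; exact hP0, hal⟩, ?_⟩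
    have e := visits_add_eq_left (k := k) (b := 6) (ζ := ω) (fun j hj1 hj6 => hoff (k + j) (by omega) (by omega))
    rw [show k + 7 = k + 6 + 1 by omega, visits_succ, if_pos (by rw [show k + 6 + 1 = k + 7 by omega]; exact hend), e, hpv]
  have hinj : Set.InjOn g ↑(fibA (k + 4) k) := by
    intro ω hω ω' hω' h
    rw [Finset.mem_coe] at hω hω'
    simp only [hg, Prod.mk.injEq] at h
    obtain ⟨h1, h2⟩ := h
    have hagree : ∀ i ≤ k, ω i = ω' i := fun i hi => by
      have := congrFun h1 i
      simpa [Zd.prefixWalk, min_eq_left hi] using this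
    have hb : (ω (k + 2) 0 = 1) ↔ (ω' (k + 2) 0 = 1) := by simpa using h2
    have hωs : ω ∈ saws (k + 7) := by
      have := (fibA_anatomy hω).1; rw [show k + 4 + 3 = k + 7 by omega] at this; exact hp_subset this
    have hωs' : ω' ∈ saws (k + 7) := by
      have := (fibA_anatomy hω').1; rw [show k + 4 + 3 = k + 7 by omega] at this; exact hp_subset this
    have eY : ω k 1 = ω' k 1 := by rw [hagree k le_rfl]
    have eYm : ω (k - 1) 1 = ω' (k - 1) 1 := by rw [hagree (k - 1) (by omega)]
    obtain ⟨-, ⟨hX1, hY1⟩, hc⟩ := fibA_seven_coords₂ hk hω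
    obtain ⟨-, ⟨hX1', hY1'⟩, hc'⟩ := fibA_seven_coords₂ hk hω'
    refine eq_of_agree hωs hωs' fun i hi => ?_
    rcases Nat.lt_or_ge i (k + 1) with hi' | hi'
    · exact hagree i (by omega)
    · rw [site_two_eq_iff]
      have hcase : i = k + 1 ∨ i = k + 2 ∨ i = k + 3 ∨ i = k + 4 ∨ i = k + 5 ∨ i = k + 6 ∨ i = k + 7 := by omega
      rcases hc with ⟨a0, a1, b0, b1, c0, c1, d0, d1, e0, e1, f0, f1⟩ | ⟨a0, a1, b0, b1, c0, c1, d0, d1, e0, e1, f0, f1⟩ <;>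
        rcases hc' with ⟨a0', a1', b0', b1', c0', c1', d0', d1', e0', e1', f0', f1'⟩ |
          ⟨a0', a1', b0', b1', c0', c1', d0', d1', e0', e1', f0', f1'⟩
      · rcases hcase with rfl | rfl | rfl | rfl | rfl | rfl | rfl
        · exact ⟨by rw [hX1, hX1'], by rw [hY1, hY1', eY]⟩
        · exact ⟨by rw [a0, a0'], by rw [a1, a1', eY, eYm]⟩
        · exact ⟨by rw [b0, b0'], by rw [b1, b1', eY, eYm]⟩
        · exact ⟨by rw [c0, c0'], by rw [c1, c1', eY, eYm]⟩
        · exact ⟨by rw [d0, d0'], by rw [d1, d1', eY, eYm]⟩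
        · exact ⟨by rw [e0, e0'], by rw [e1, e1', eY, eYm]⟩
        · exact ⟨by rw [f0, f0'], by rw [f1, f1', eY, eYm]⟩
      · exfalso; rw [a0, a0'] at hb; norm_num at hb
      · exfalso; rw [a0, a0'] at hb; norm_num at hb
      · rcases hcase with rfl | rfl | rfl | rfl | rfl | rfl | rfl
        · exact ⟨by rw [hX1, hX1'], by rw [hY1, hY1', eY]⟩
        · exact ⟨by rw [a0, a0'], by rw [a1, a1', eY]⟩
        · exact ⟨by rw [b0, b0'], by rw [b1, b1', eY]⟩
        · exact ⟨by rw [c0, c0'], by rw [c1, c1', eY, eYm]⟩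
        · exact ⟨by rw [d0, d0'], by rw [d1, d1', eY, eYm]⟩
        · exact ⟨by rw [e0, e0'], by rw [e1, e1', eY, eYm]⟩
        · exact ⟨by rw [f0, f0'], by rw [f1, f1', eY, eYm]⟩
  calc ∑ ω ∈ fibA (k + 4) k, y ^ visits (k + 7) ω = ∑ ω ∈ fibA (k + 4) k, y * y ^ visits k (g ω).1 :=
        Finset.sum_congr rfl fun ω hω => by simp only [hg]; rw [(hprops ω hω).2, pow_succ, mul_comm]
    _ = ∑ p ∈ (fibA (k + 4) k).image g, y * y ^ visits k p.1 := by rw [Finset.sum_image hinj]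
    _ ≤ ∑ p ∈ archesB2 k ×ˢ (Finset.univ : Finset Bool), y * y ^ visits k p.1 := by
        refine Finset.sum_le_sum_of_subset_of_nonneg (fun p hp' => ?_) fun _ _ _ => mul_nonneg hy (pow_nonneg hy _)
        obtain ⟨ω, hω, rfl⟩ := Finset.mem_image.1 hp'
        exact Finset.mem_product.2 ⟨(hprops ω hω).1, Finset.mem_univ _⟩
    _ = 2 * y * bW k y := by
        rw [Finset.sum_product, bW, Finset.mul_sum]
        refine Finset.sum_congr rfl fun ξ _ => ?_
        simp only [Finset.sum_const, Finset.card_univ, Fintype.card_bool, nsmul_eq_mul]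
        push_cast
        ring

/-! ### §5  The alive two-class recursion -/

open Classical in
/-- **`a_{j+9}(y) ≤ y b_{j+6}(y) + 2y b_{j+2}(y) + y Σ_{k ≤ j+1} X_k(y) c_{j+8−k}(ℍ)`** (`y ≥ 0`).  Fibre the alive class-`A` arches of
length `j+9` by the last-but-one wall visit `k ≤ j+8`: `k = j+8, j+7` are empty, `k = j+6` is the connector (`≤ y b_{j+6}`), `k = j+5, j+4`
are empty (no excursions of length `4`, `5`), `k = j+3` contributes NOTHING among ALIVE arches (the length-`6` skip-and-return is a dead
end), `k = j+2` is the two length-`7` shapes (`≤ 2y b_{j+2}`), and `k ≤ j+1` the generic prefix/suffix split.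
[cite: HammersleyTorrieWhittington1982, §2 (as summarised by Beaton 2014 arXiv v3 p. 11; locator provisional); MadrasSlade1993, §1.2, (1.2.3)] -/
theorem aW_le_rec (j : ℕ) (hy : 0 ≤ y) :
    aW (j + 9) y ≤ y * bW (j + 6) y + 2 * y * bW (j + 2) y + y * ∑ k ∈ range (j + 2), X2w k y * #(saws (j + 8 - k)) := by
  set T : ℕ → ℝ := fun k => ∑ ω ∈ (archesA2 (j + 9)).filter (fun ω => lastV (j + 8) ω = k), y ^ visits (j + 9) ω with hT
  have hdec : aW (j + 9) y = ∑ k ∈ range (j + 9), T k := by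
    have hf : ∀ ω ∈ archesA2 (j + 9), lastV (j + 8) ω ∈ range (j + 9) :=
      fun ω _ => Finset.mem_range.2 (Nat.lt_succ_of_le (lastV_le _ _))
    rw [aW, ← Finset.sum_fiberwise_of_maps_to hf]
  have hsub : ∀ k, (archesA2 (j + 9)).filter (fun ω => lastV (j + 8) ω = k) ⊆ fibA (j + 6) k := by
    intro k ω hω
    obtain ⟨hωA, hk⟩ := Finset.mem_filter.1 hω
    obtain ⟨hωa, hA, -⟩ := Finset.mem_filter.1 hωA
    exact Finset.mem_filter.2 ⟨Finset.mem_filter.2 ⟨hωa, hA⟩, hk⟩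
  have hTle : ∀ k, T k ≤ ∑ ω ∈ fibA (j + 6) k, y ^ visits (j + 9) ω := fun k =>
    Finset.sum_le_sum_of_subset_of_nonneg (hsub k) fun _ _ _ => pow_nonneg hy _
  have hTnn : ∀ k, 0 ≤ T k := fun k => Finset.sum_nonneg fun _ _ => pow_nonneg hy _
  -- the seven top fibres
  have h8 : T (j + 8) ≤ 0 := by
    refine (hTle _).trans ?_; rw [show j + 8 = j + 6 + 2 by omega, fibA_top_eq_empty, Finset.sum_empty]
  have h7 : T (j + 7) ≤ 0 := by
    refine (hTle _).trans ?_; rw [show j + 7 = j + 6 + 1 by omega, fibA_pred_eq_empty, Finset.sum_empty]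
  have h6 : T (j + 6) ≤ y * bW (j + 6) y := (hTle _).trans (sum_fibA_self_le_bW (j + 6) hy)
  have h5 : T (j + 5) ≤ 0 := by
    refine (hTle _).trans (le_of_eq (Finset.sum_eq_zero fun ω hω => ?_))
    exact absurd hω (not_mem_fibA_four (j + 5) ω)
  have h4 : T (j + 4) ≤ 0 := by
    refine (hTle _).trans (le_of_eq (Finset.sum_eq_zero fun ω hω => ?_))
    exact absurd hω (not_mem_fibA_five (k := j + 4) (by omega) ω)
  have h3 : T (j + 3) ≤ 0 := by
    refine le_of_eq (Finset.sum_eq_zero fun ω hω => ?_)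
    obtain ⟨hωA, hk⟩ := Finset.mem_filter.1 hω
    obtain ⟨-, -, hal⟩ := Finset.mem_filter.1 hωA
    exact absurd hal (not_alive_of_mem_fibA_six (k := j + 3) (by omega) (hsub _ hω))
  have h2 : T (j + 2) ≤ 2 * y * bW (j + 2) y := (hTle _).trans (sum_fibA_seven_le (k := j + 2) (by omega) hy)
  have hlow : ∑ k ∈ range (j + 2), T k ≤ y * ∑ k ∈ range (j + 2), X2w k y * #(saws (j + 8 - k)) := by
    rw [Finset.mul_sum]
    refine Finset.sum_le_sum fun k hk => (hTle k).trans ?_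
    have hk' := Finset.mem_range.1 hk
    have := sum_fibA_le_X2 (j + 6) hy (k := k) (by omega)
    rwa [show j + 6 + 2 - k = j + 8 - k by omega] at this
  rw [hdec, Finset.sum_range_succ, Finset.sum_range_succ, Finset.sum_range_succ, Finset.sum_range_succ, Finset.sum_range_succ,
    Finset.sum_range_succ, Finset.sum_range_succ]
  linarith [hTnn (j + 8), hTnn (j + 7)]

/-! ### §6  Growth bound -/

open Classical in
/-- `a_n ≤ X_n ≤ A_n`. [cite: HammersleyTorrieWhittington1982, §2] -/
theorem aW_le_Aw (n : ℕ) (hy : 0 ≤ y) : aW n y ≤ Aw n y := by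
  have := X2w_le_Aw n hy; rw [X2w_eq] at this; linarith [bW_nonneg n hy]

open Classical in
/-- `b_n ≤ X_n ≤ A_n`. [cite: HammersleyTorrieWhittington1982, §2] -/
theorem bW_le_Aw (n : ℕ) (hy : 0 ≤ y) : bW n y ≤ Aw n y := by
  have := X2w_le_Aw n hy; rw [X2w_eq] at this; linarith [aW_nonneg n hy]

set_option maxHeartbeats 400000 in
/-- **Growth bound** (`y ≥ 1`, `ρ ≥ 6`, `y²ρ⁵ + 2y²ρ + 4374yρ + 10935y² ≤ ρ⁹`): `a_n(y) ≤ 3⁹y¹⁰ ρⁿ` and `b_n(y) ≤ 3⁹y¹¹ ρ^{n−1}`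
(simultaneous strong induction on `n` through `aW_le_rec` and `bW_le`; `4374 = 2·3⁷`, `10935 = 3⁸ + 2·3⁷`).
[cite: MadrasSlade1993, §1.2, Lemma 1.2.2; HammersleyTorrieWhittington1982, §2] -/
theorem aW_bW_le_mul_pow (hy : 1 ≤ y) {ρ : ℝ} (hρ : 6 ≤ ρ)
    (hc : y ^ 2 * ρ ^ 5 + 2 * y ^ 2 * ρ + 4374 * y * ρ + 10935 * y ^ 2 ≤ ρ ^ 9) (n : ℕ) :
    aW n y ≤ 3 ^ 9 * y ^ 10 * ρ ^ n ∧ bW n y ≤ 3 ^ 9 * y ^ 10 * y * ρ ^ (n - 1) := by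
  have hy0 : 0 ≤ y := by linarith
  have hρ1 : 1 ≤ ρ := by linarith
  have hρ0 : 0 < ρ := by linarith
  have hρ3 : (3 : ℝ) ≤ ρ := by linarith
  set K : ℝ := 3 ^ 9 * y ^ 10 with hK
  have hK0 : 0 ≤ K := by positivity
  -- a priori bound for short lengths
  have hapr : ∀ n ≤ 8, Aw n y ≤ K ∧ Aw n y ≤ K * y := by
    intro n hn
    have h1 := Aw_le_card_mul_pow n hy0
    rw [max_eq_right hy] at h1
    have h2 : (#(saws n) : ℝ) * y ^ (n + 1) ≤ 3 ^ n * y ^ (n + 1) :=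
      mul_le_mul_of_nonneg_right (card_saws_le_three_pow n) (pow_nonneg hy0 _)
    have h3 : (3 : ℝ) ^ n ≤ 3 ^ 9 := pow_le_pow_right₀ (by norm_num) (by omega)
    have h4 : y ^ (n + 1) ≤ y ^ 10 := pow_le_pow_right₀ hy (by omega)
    have hA : Aw n y ≤ K := (h1.trans h2).trans (mul_le_mul h3 h4 (pow_nonneg hy0 _) (by positivity))
    exact ⟨hA, hA.trans (le_mul_of_one_le_right hK0 hy)⟩
  induction n using Nat.strong_induction_on with
  | _ n ih =>
  rcases Nat.lt_or_ge n 9 with hn | hn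
  · obtain ⟨hA, hAy⟩ := hapr n (by omega)
    have h5 : (1 : ℝ) ≤ ρ ^ n := one_le_pow₀ hρ1
    have h6 : (1 : ℝ) ≤ ρ ^ (n - 1) := one_le_pow₀ hρ1
    refine ⟨(aW_le_Aw n hy0).trans (hA.trans ?_), (bW_le_Aw n hy0).trans (hAy.trans ?_)⟩
    · calc K = K * 1 := (mul_one _).symm
        _ ≤ K * ρ ^ n := mul_le_mul_of_nonneg_left h5 hK0
    · calc K * y = K * y * 1 := (mul_one _).symm
        _ ≤ K * y * ρ ^ (n - 1) := mul_le_mul_of_nonneg_left h6 (by positivity)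
  · obtain ⟨j, rfl⟩ : ∃ j, n = j + 9 := ⟨n - 9, by omega⟩
    have ha : ∀ k < j + 9, aW k y ≤ K * ρ ^ k := fun k hk => (ih k hk).1
    have hb : ∀ k < j + 9, bW k y ≤ K * y * ρ ^ (k - 1) := fun k hk => (ih k hk).2
    -- the `b`-bound at `j+9` from `bW_le` and the `a`-bound at `j+8`
    have hB9 : bW (j + 9) y ≤ K * y * ρ ^ (j + 9 - 1) := by
      have h1 := bW_le (j + 7) hy0
      rw [show j + 7 + 2 = j + 9 by omega, show j + 7 + 1 = j + 8 by omega] at h1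
      have h2 := ha (j + 8) (by omega)
      rw [show j + 9 - 1 = j + 8 by omega]
      calc bW (j + 9) y ≤ y * aW (j + 8) y := h1
        _ ≤ y * (K * ρ ^ (j + 8)) := mul_le_mul_of_nonneg_left h2 hy0
        _ = K * y * ρ ^ (j + 8) := by ring
    refine ⟨?_, hB9⟩
    have hrec := aW_le_rec j hy0
    have hb6 := hb (j + 6) (by omega)
    rw [show j + 6 - 1 = j + 5 by omega] at hb6
    have hb2 := hb (j + 2) (by omega)
    rw [show j + 2 - 1 = j + 1 by omega] at hb2
    -- the tail sum
    have hX : ∀ k < j + 2, X2w k y * (#(saws (j + 8 - k)) : ℝ) ≤ K * (ρ ^ k * 3 ^ (j + 1 + 7 - k)) + K * y * (ρ ^ (k - 1) * 3 ^ (j + 8 - k)) := by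
      intro k hk
      have h1 : X2w k y ≤ K * ρ ^ k + K * y * ρ ^ (k - 1) := by
        rw [X2w_eq]; exact add_le_add (ha k (by omega)) (hb k (by omega))
      have h2 : (#(saws (j + 8 - k)) : ℝ) ≤ 3 ^ (j + 8 - k) := card_saws_le_three_pow _
      calc X2w k y * (#(saws (j + 8 - k)) : ℝ) ≤ (K * ρ ^ k + K * y * ρ ^ (k - 1)) * 3 ^ (j + 8 - k) :=
            mul_le_mul h1 h2 (Nat.cast_nonneg _) (by positivity)
        _ = K * (ρ ^ k * 3 ^ (j + 1 + 7 - k)) + K * y * (ρ ^ (k - 1) * 3 ^ (j + 8 - k)) := by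
            rw [show j + 1 + 7 - k = j + 8 - k by omega]; ring
    have hS1 : ∑ k ∈ range (j + 2), ρ ^ k * (3 : ℝ) ^ (j + 1 + 7 - k) ≤ 2 * 3 ^ 7 * ρ ^ (j + 1) :=
      sum_pow_mul_three_pow_le hρ (j + 1) 7
    have hS2 : ∑ k ∈ range (j + 2), ρ ^ (k - 1) * (3 : ℝ) ^ (j + 8 - k) ≤ 10935 * ρ ^ j := by
      rw [Finset.sum_range_succ']
      simp only [Nat.zero_sub, pow_zero, one_mul, Nat.sub_zero, Nat.add_sub_cancel]
      have e : ∑ i ∈ range (j + 1), ρ ^ i * (3 : ℝ) ^ (j + 8 - (i + 1)) = ∑ i ∈ range (j + 1), ρ ^ i * (3 : ℝ) ^ (j + 7 - i) :=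
        Finset.sum_congr rfl fun i _ => by rw [show j + 8 - (i + 1) = j + 7 - i by omega]
      rw [e]
      have h1 := sum_pow_mul_three_pow_le hρ j 7
      have h2 : (3 : ℝ) ^ (j + 8) ≤ 3 ^ 8 * ρ ^ j := by
        rw [pow_add, mul_comm]; exact mul_le_mul_of_nonneg_left (pow_le_pow_left₀ (by norm_num) hρ3 j) (by norm_num)
      nlinarith [pow_nonneg hρ0.le j]
    have htail : ∑ k ∈ range (j + 2), X2w k y * (#(saws (j + 8 - k)) : ℝ) ≤ K * (2 * 3 ^ 7 * ρ ^ (j + 1)) + K * y * (10935 * ρ ^ j) := by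
      calc ∑ k ∈ range (j + 2), X2w k y * (#(saws (j + 8 - k)) : ℝ)
          ≤ ∑ k ∈ range (j + 2), (K * (ρ ^ k * 3 ^ (j + 1 + 7 - k)) + K * y * (ρ ^ (k - 1) * 3 ^ (j + 8 - k))) :=
            Finset.sum_le_sum fun k hk => hX k (Finset.mem_range.1 hk)
        _ = K * ∑ k ∈ range (j + 2), ρ ^ k * 3 ^ (j + 1 + 7 - k) + K * y * ∑ k ∈ range (j + 2), ρ ^ (k - 1) * 3 ^ (j + 8 - k) := by
            rw [Finset.sum_add_distrib, Finset.mul_sum, Finset.mul_sum]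
        _ ≤ K * (2 * 3 ^ 7 * ρ ^ (j + 1)) + K * y * (10935 * ρ ^ j) :=
            add_le_add (mul_le_mul_of_nonneg_left hS1 hK0) (mul_le_mul_of_nonneg_left hS2 (by positivity))
    -- assemble
    have hmain : y * (K * y * ρ ^ (j + 5)) + 2 * y * (K * y * ρ ^ (j + 1)) +
        y * (K * (2 * 3 ^ 7 * ρ ^ (j + 1)) + K * y * (10935 * ρ ^ j)) ≤ K * ρ ^ (j + 9) := by
      have e1 : y * (K * y * ρ ^ (j + 5)) + 2 * y * (K * y * ρ ^ (j + 1)) +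
          y * (K * (2 * 3 ^ 7 * ρ ^ (j + 1)) + K * y * (10935 * ρ ^ j)) =
          K * ρ ^ j * (y ^ 2 * ρ ^ 5 + 2 * y ^ 2 * ρ + 4374 * y * ρ + 10935 * y ^ 2) := by ring
      have e2 : K * ρ ^ (j + 9) = K * ρ ^ j * ρ ^ 9 := by ring
      rw [e1, e2]
      exact mul_le_mul_of_nonneg_left hc (by positivity)
    calc aW (j + 9) y ≤ y * bW (j + 6) y + 2 * y * bW (j + 2) y + y * ∑ k ∈ range (j + 2), X2w k y * #(saws (j + 8 - k)) := hrec
      _ ≤ y * (K * y * ρ ^ (j + 5)) + 2 * y * (K * y * ρ ^ (j + 1)) +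
            y * (K * (2 * 3 ^ 7 * ρ ^ (j + 1)) + K * y * (10935 * ρ ^ j)) := by
          have := mul_le_mul_of_nonneg_left hb6 hy0
          have := mul_le_mul_of_nonneg_left hb2 (by positivity : (0 : ℝ) ≤ 2 * y)
          have := mul_le_mul_of_nonneg_left htail hy0
          linarith
      _ ≤ K * ρ ^ (j + 9) := hmain

/-! ### §7  The second-order upper bound: `β_rot(y)⁴ ≤ y² + 2 + 15309/√y` -/

/-- The radius `ρ(y) = (y² + 2 + 15309/√y)^{1/4}` satisfies the growth condition of `aW_bW_le_mul_pow` and `ρ ≥ 6` (`y ≥ 1`).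
[cite: MadrasSlade1993, §1.2, Lemma 1.2.2] -/
theorem rho_facts (hy : 1 ≤ y) :
    let t := Real.sqrt (Real.sqrt (y ^ 2 + 2 + 15309 / Real.sqrt y))
    0 < t ∧ 6 ≤ t ∧ t ^ 4 = y ^ 2 + 2 + 15309 / Real.sqrt y ∧
      y ^ 2 * t ^ 5 + 2 * y ^ 2 * t + 4374 * y * t + 10935 * y ^ 2 ≤ t ^ 9 := by
  intro t
  have hy0 : 0 ≤ y := by linarith
  set s := Real.sqrt y with hs
  have hs0 : 0 < s := Real.sqrt_pos.2 (by linarith)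
  have hs1 : 1 ≤ s := by rw [hs, ← Real.sqrt_one]; exact Real.sqrt_le_sqrt hy
  have hys : y = s ^ 2 := (Real.sq_sqrt hy0).symm
  set R := y ^ 2 + 2 + 15309 / s with hR
  have hD0 : 0 ≤ 2 + 15309 / s := by positivity
  have hRy : y ^ 2 ≤ R := by rw [hR]; linarith [hD0]
  have hR0 : 0 ≤ R := le_trans (by positivity) hRy
  have ht0 : 0 ≤ t := Real.sqrt_nonneg _
  have ht2 : t ^ 2 = Real.sqrt R := Real.sq_sqrt (Real.sqrt_nonneg _)
  have ht4 : t ^ 4 = R := by rw [show t ^ 4 = (t ^ 2) ^ 2 by ring, ht2, Real.sq_sqrt hR0]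
  -- `t ≥ s` (fourth root is monotone: `R ≥ y² = s⁴`)
  have hts : s ≤ t := by
    have h1 : y ≤ Real.sqrt R := by
      rw [show y = Real.sqrt (y ^ 2) from (Real.sqrt_sq hy0).symm]; exact Real.sqrt_le_sqrt hRy
    exact Real.sqrt_le_sqrt h1
  have htpos : 0 < t := lt_of_lt_of_le hs0 hts
  -- `t ≥ 6`: `R ≥ 1296`
  have hR6 : (1296 : ℝ) ≤ R := by
    rcases le_or_gt 36 y with h36 | h36
    · nlinarith [hRy]
    · have hs6 : s < 6 := by
        rw [hs, show (6 : ℝ) = Real.sqrt 36 by rw [show (36 : ℝ) = 6 ^ 2 by norm_num, Real.sqrt_sq (by norm_num)]]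
        exact Real.sqrt_lt_sqrt hy0 h36
      have h1 : (1296 : ℝ) ≤ 15309 / s := by rw [le_div_iff₀ hs0]; nlinarith
      rw [hR]; nlinarith
  have ht6 : 6 ≤ t := by
    by_contra h
    push Not at h
    have : t ^ 4 < 6 ^ 4 := pow_lt_pow_left₀ h ht0 (by norm_num)
    rw [ht4] at this; norm_num at this; linarith
  refine ⟨htpos, ht6, ht4, ?_⟩
  -- the growth condition: `t (R² − y²R − 2y² − 4374y) ≥ s · 10935 y s = 10935 y²`
  have hRD : R * (R - y ^ 2) ≥ 2 * y ^ 2 + 15309 * y * s := by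
    have e : R - y ^ 2 = 2 + 15309 / s := by rw [hR]; ring
    rw [e]
    have h1 : y ^ 2 * (2 + 15309 / s) = 2 * y ^ 2 + 15309 * y * s := by
      rw [hys]; field_simp
    rw [← h1]
    exact mul_le_mul_of_nonneg_right hRy hD0
  have hkey : 10935 * y * s ≤ R ^ 2 - y ^ 2 * R - 2 * y ^ 2 - 4374 * y := by nlinarith
  have hkey0 : 0 ≤ R ^ 2 - y ^ 2 * R - 2 * y ^ 2 - 4374 * y := le_trans (by positivity) hkey
  have h5 : t ^ 5 = t * R := by rw [show t ^ 5 = t * t ^ 4 by ring, ht4]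
  have h9 : t ^ 9 = t * R ^ 2 := by rw [show t ^ 9 = t * (t ^ 4) ^ 2 by ring, ht4]
  rw [h5, h9]
  have h1 : s * (10935 * y * s) ≤ t * (R ^ 2 - y ^ 2 * R - 2 * y ^ 2 - 4374 * y) :=
    mul_le_mul hts hkey (by positivity) ht0
  have h2 : s * (10935 * y * s) = 10935 * y ^ 2 := by rw [hys]; ring
  nlinarith

/-- **Second-order UPPER bound for the armchair (rotated-honeycomb) surface growth rate**: `β_rot(y)⁴ ≤ y² + 2 + 15309/√y` for every
`y ≥ 1` — i.e. `β_rot(y)² ≤ y + 1/y + O(y^{−3/2})`: the coefficient of `1/y` in the adsorbed-phase expansion of Beaton's armchair-wall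
model is AT MOST `1` (two-step-alive arches: the cheapest renewal pieces per slot are ONE skip-a-dimer excursion and ONE wide connector).
[cite: Beaton2014RotatedHoneycomb, §3 (arXiv v3 pp. 10–11: the rotated surface model), §3.1 (p. 12: unfolded walks); HammersleyTorrieWhittington1982, §2; MadrasSlade1993, §1.2, Lemma 1.2.2, (1.2.17)] -/
theorem armRate_pow_four_le (hy : 1 ≤ y) : armRate y ^ 4 ≤ y ^ 2 + 2 + 15309 / Real.sqrt y := by
  obtain ⟨ht0, ht6, ht4, hc⟩ := rho_facts hy
  set t := Real.sqrt (Real.sqrt (y ^ 2 + 2 + 15309 / Real.sqrt y)) with ht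
  have hy0 : 0 < y := by linarith
  have ht1 : 1 ≤ t := by linarith
  set K : ℝ := 3 ^ 9 * y ^ 10 with hK
  have hK0 : 0 < K := by positivity
  have hgrowth := aW_bW_le_mul_pow hy ht6 hc
  have hWB : ∀ n, WB n y ≤ K * (1 + y) * t ^ n := by
    intro n
    rcases Nat.eq_zero_or_pos n with hn | hn
    · subst hn
      have h1 := (WB_le_Aw 0 hy0.le).trans (Aw_le_card_mul_pow 0 hy0.le)
      rw [max_eq_right hy] at h1
      have h2 : (#(saws 0) : ℝ) ≤ 3 ^ 0 := card_saws_le_three_pow 0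
      simp only [zero_add, pow_one, pow_zero] at h1 h2
      have h3 : WB 0 y ≤ y := h1.trans (by nlinarith [mul_le_mul_of_nonneg_right h2 hy0.le])
      have h4 : y ≤ K * (1 + y) * t ^ 0 := by
        rw [pow_zero, mul_one]
        have hK1 : (1 : ℝ) ≤ K := by
          rw [hK]; exact one_le_mul_of_one_le_of_one_le (by norm_num) (one_le_pow₀ hy)
        nlinarith [mul_nonneg (sub_nonneg.2 hK1) hy0.le]
      exact h3.trans h4
    · obtain ⟨ha, hb⟩ := hgrowth n
      have h1 := WB_le_X2w hn hy0.le (n := n)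
      rw [X2w_eq] at h1
      have h2 : t ^ (n - 1) ≤ t ^ n := pow_le_pow_right₀ ht1 (by omega)
      have h3 : bW n y ≤ K * y * t ^ n := hb.trans (mul_le_mul_of_nonneg_left h2 (by positivity))
      calc WB n y ≤ aW n y + bW n y := h1
        _ ≤ K * t ^ n + K * y * t ^ n := add_le_add ha h3
        _ = K * (1 + y) * t ^ n := by ring
  have hβ := armRate_le_of_WB_le hy0 (by positivity : 0 < K * (1 + y)) ht0 hWB
  calc armRate y ^ 4 ≤ t ^ 4 := pow_le_pow_left₀ (armRate_pos y).le hβ 4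
    _ = y ^ 2 + 2 + 15309 / Real.sqrt y := ht4

/-- **`β_rot(y)² ≤ y + 1/y + 7655/(y√y)`** (`y ≥ 1`): from `β_rot⁴ ≤ y² + D`, `β_rot² ≤ √(y² + D) ≤ y + D/(2y)`.
[cite: Beaton2014RotatedHoneycomb, §3.1 (arXiv v3 p. 12); MadrasSlade1993, §1.2, (1.2.17)] -/
theorem armRate_sq_le_second (hy : 1 ≤ y) : armRate y ^ 2 ≤ y + 1 / y + 7655 / (y * Real.sqrt y) := by
  have hy0 : 0 < y := by linarith
  have hs0 : 0 < Real.sqrt y := Real.sqrt_pos.2 hy0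
  have h4 := armRate_pow_four_le hy
  set D := 2 + 15309 / Real.sqrt y with hD
  have hD0 : 0 ≤ D := by positivity
  have hb0 : 0 ≤ armRate y ^ 2 := sq_nonneg _
  -- `β² ≤ y + D/(2y)` since `(y + D/(2y))² ≥ y² + D ≥ β⁴`
  have h1 : armRate y ^ 2 ≤ y + D / (2 * y) := by
    have hrhs : 0 ≤ y + D / (2 * y) := by positivity
    have h2 : (armRate y ^ 2) ^ 2 ≤ (y + D / (2 * y)) ^ 2 := by
      have e : (y + D / (2 * y)) ^ 2 = y ^ 2 + D + (D / (2 * y)) ^ 2 := by field_simp; ring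
      rw [e]; nlinarith [sq_nonneg (D / (2 * y))]
    exact (pow_le_pow_iff_left₀ hb0 hrhs two_ne_zero).1 h2
  have e : y + D / (2 * y) = y + 1 / y + 15309 / (2 * (y * Real.sqrt y)) := by rw [hD]; field_simp; ring
  rw [e] at h1
  have h3 : 15309 / (2 * (y * Real.sqrt y)) ≤ 7655 / (y * Real.sqrt y) := by
    rw [div_le_div_iff₀ (by positivity) (by positivity)]; nlinarith [mul_pos hy0 hs0]
  linarith

/-- **`y · (β_rot(y)² − y) ≤ 1 + 7655/√y`** (`y ≥ 1`): `limsup_{y→∞} y(β_rot(y)² − y) ≤ 1`.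
[cite: Beaton2014RotatedHoneycomb, §3.1 (arXiv v3 p. 12)] -/
theorem mul_armRate_sq_sub_le (hy : 1 ≤ y) : y * (armRate y ^ 2 - y) ≤ 1 + 7655 / Real.sqrt y := by
  have hy0 : 0 < y := by linarith
  have hs0 : 0 < Real.sqrt y := Real.sqrt_pos.2 hy0
  have h := armRate_sq_le_second hy
  have e1 : y * (y + 1 / y + 7655 / (y * Real.sqrt y)) = y * y + 1 + 7655 / Real.sqrt y := by field_simp
  nlinarith [mul_le_mul_of_nonneg_left h hy0.le]

/-- **Eventually `y (β_rot(y)² − y) ≤ 1 + ε`** for every `ε > 0`. [cite: Beaton2014RotatedHoneycomb, §3.1 (arXiv v3 p. 12)] -/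
theorem eventually_mul_armRate_sq_sub_le {ε : ℝ} (hε : 0 < ε) :
    ∀ᶠ y : ℝ in atTop, y * (armRate y ^ 2 - y) ≤ 1 + ε := by
  have h1 : Tendsto (fun y : ℝ => 7655 / Real.sqrt y) atTop (𝓝 0) :=
    tendsto_const_nhds.div_atTop (Real.tendsto_sqrt_atTop)
  filter_upwards [eventually_ge_atTop (1 : ℝ), (tendsto_order.1 h1).2 ε hε] with y hy hlt
  exact (mul_armRate_sq_sub_le hy).trans (by linarith)

/-- **`β_rot(y)² − y = O(1/y)`** as `y → ∞` (with `β_rot(y)² > y` from `HexSAWArmchairSqrtStrict`).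
[cite: Beaton2014RotatedHoneycomb, §3.1 (arXiv v3 p. 12)] -/
theorem isBigO_armRate_sq_sub : (fun y : ℝ => armRate y ^ 2 - y) =O[atTop] (fun y : ℝ => 1 / y) := by
  refine Asymptotics.IsBigO.of_bound 7656 ?_
  filter_upwards [eventually_ge_atTop (1 : ℝ)] with y hy
  have hy0 : 0 < y := by linarith
  have hs1 : 1 ≤ Real.sqrt y := by rw [← Real.sqrt_one]; exact Real.sqrt_le_sqrt hy
  have hlow : 0 ≤ armRate y ^ 2 - y := by
    have := sqrt_lt_armRate hy0
    have h2 : Real.sqrt y ^ 2 = y := Real.sq_sqrt hy0.le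
    nlinarith [Real.sqrt_nonneg y, (armRate_pos y).le]
  have hup := mul_armRate_sq_sub_le hy
  have h7 : 7655 / Real.sqrt y ≤ 7655 := by rw [div_le_iff₀ (by linarith)]; nlinarith
  rw [Real.norm_of_nonneg hlow, Real.norm_of_nonneg (by positivity : (0 : ℝ) ≤ 1 / y)]
  rw [show 7656 * (1 / y) = 7656 / y by ring, le_div_iff₀ hy0]
  nlinarith

/-! ### §8  The lower side `β_rot(y)² − y ≥ 1/(16y)` and the exact order `Θ(1/y)` -/

/-- `(1 + v)⁸ ≤ 1 + 11 v` for `0 ≤ v ≤ 1/16` (three squarings). [cite: MadrasSlade1993, §1.2, (1.2.17)] -/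
theorem one_add_pow_eight_le {v : ℝ} (hv0 : 0 ≤ v) (hv : v ≤ 1 / 16) : (1 + v) ^ 8 ≤ 1 + 11 * v := by
  have hvv : v * v ≤ v / 16 := by nlinarith
  have h2 : (1 + v) ^ 2 ≤ 1 + 33 / 16 * v := by nlinarith
  have h2' : 0 ≤ (1 + v) ^ 2 := by positivity
  have h4 : (1 + v) ^ 4 ≤ 1 + 9 / 2 * v := by
    have := mul_le_mul h2 h2 h2' (by positivity)
    rw [show (1 + v) ^ 4 = (1 + v) ^ 2 * (1 + v) ^ 2 by ring]
    nlinarith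
  have h4' : 0 ≤ (1 + v) ^ 4 := by positivity
  have := mul_le_mul h4 h4 h4' (by positivity)
  rw [show (1 + v) ^ 8 = (1 + v) ^ 4 * (1 + v) ^ 4 by ring]
  nlinarith

/-- **`y + 1/(16y) ≤ β_rot(y)²`** for `y ≥ 1`: from the tree's `β_rot(y)¹⁶ ≥ y⁸(1 + y⁻²)` (two explicit wall bridges of length `13`,
`HexSAWArmchairSqrtStrict`) and `(1 + u/16)⁸ ≤ 1 + u` (`0 ≤ u ≤ 1`).
[cite: Beaton2014RotatedHoneycomb, Proposition 7 (arXiv v3 p. 11: "μ(y) ≥ max{μ, √y}"); MadrasSlade1993, §1.2, (1.2.17)] -/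
theorem add_div_le_armRate_sq (hy : 1 ≤ y) : y + 1 / (16 * y) ≤ armRate y ^ 2 := by
  have hy0 : 0 < y := by linarith
  have h16 := armRate_pow_sixteen_ge hy0
  have hb0 : 0 ≤ armRate y ^ 2 := sq_nonneg _
  set v : ℝ := 1 / (16 * y ^ 2) with hv
  have hv0 : 0 ≤ v := by positivity
  have hv1 : v ≤ 1 / 16 := by
    rw [hv, div_le_div_iff₀ (by positivity) (by norm_num)]; nlinarith
  have e1 : y + 1 / (16 * y) = y * (1 + v) := by rw [hv]; field_simp
  have e2 : y ^ 8 * (1 + (y ^ 2)⁻¹) = y ^ 8 * (1 + 16 * v) := by rw [hv]; field_simp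
  by_contra h
  push Not at h
  rw [e1] at h
  have h1 : (armRate y ^ 2) ^ 8 < (y * (1 + v)) ^ 8 := pow_lt_pow_left₀ h hb0 (by norm_num)
  have h2 : (y * (1 + v)) ^ 8 ≤ y ^ 8 * (1 + 16 * v) := by
    rw [mul_pow]
    refine mul_le_mul_of_nonneg_left ((one_add_pow_eight_le hv0 hv1).trans (by nlinarith)) (by positivity)
  have h3 : (armRate y ^ 2) ^ 8 = armRate y ^ 16 := by ring
  rw [h3] at h1
  rw [e2] at h16
  linarith

/-- ★★ **Two-sided window `β_rot(y)² − y ∈ [1/(16y), 1/y + 7655/(y√y)]`** for every `y ≥ 1`.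
[cite: Beaton2014RotatedHoneycomb, §3.1 (arXiv v3 p. 12); MadrasSlade1993, §1.2, (1.2.17)] -/
theorem armRate_sq_sub_mem_Icc (hy : 1 ≤ y) :
    armRate y ^ 2 - y ∈ Set.Icc (1 / (16 * y)) (1 / y + 7655 / (y * Real.sqrt y)) := by
  refine ⟨?_, ?_⟩
  · linarith [add_div_le_armRate_sq hy]
  · linarith [armRate_sq_le_second hy]
/-- ★★ **`β_rot(y)² − y = Θ(1/y)`**: the finite-fugacity correction to the entropy-free adsorbed phase of the armchair wall is of EXACT
ORDER `1/y` in the squared rate (and `y (β_rot² − y) ∈ [1/16, 1 + 7655/√y]`). [cite: Beaton2014RotatedHoneycomb, §3.1 (arXiv v3 p. 12)] -/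
theorem isTheta_armRate_sq_sub : (fun y : ℝ => armRate y ^ 2 - y) =Θ[atTop] (fun y : ℝ => 1 / y) := by
  refine ⟨isBigO_armRate_sq_sub, Asymptotics.IsBigO.of_bound 16 ?_⟩
  filter_upwards [eventually_ge_atTop (1 : ℝ)] with y hy
  have hy0 : 0 < y := by linarith
  obtain ⟨hlo, -⟩ := armRate_sq_sub_mem_Icc hy
  have hpos : 0 < 1 / (16 * y) := by positivity
  rw [Real.norm_of_nonneg (by positivity : (0 : ℝ) ≤ 1 / y), Real.norm_of_nonneg (by linarith)]
  have e : 16 * (armRate y ^ 2 - y) ≥ 16 * (1 / (16 * y)) := by linarith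
  have e2 : 16 * (1 / (16 * y)) = 1 / y := by field_simp
  linarith

/-- `y (β_rot(y)² − y) ∈ [1/16, 1 + 7655/√y]` for `y ≥ 1`. [cite: Beaton2014RotatedHoneycomb, §3.1 (arXiv v3 p. 12)] -/
theorem mul_armRate_sq_sub_mem_Icc (hy : 1 ≤ y) :
    y * (armRate y ^ 2 - y) ∈ Set.Icc (1 / 16) (1 + 7655 / Real.sqrt y) := by
  have hy0 : 0 < y := by linarith
  refine ⟨?_, mul_armRate_sq_sub_le hy⟩
  have h := add_div_le_armRate_sq hy
  have e : y * (y + 1 / (16 * y)) = y * y + 1 / 16 := by field_simp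
  nlinarith [mul_le_mul_of_nonneg_left h hy0.le]

end Literature.Probability.RandomPlanarGeometry.SAW.HexBW.Arm

/-! ### §9  Transfer to Beaton's `μ_rot(y) = HV.rotSurfaceMu y` (`= β_rot(y)` for `y ≥ 4`) -/

namespace Literature.Probability.RandomPlanarGeometry.SAW.HV

open Literature.Probability.RandomPlanarGeometry.SAW.HexBW.Arm

variable {y : ℝ}

/-- **`μ_rot(y)⁴ ≤ y² + 2 + 15309/√y`** for `y ≥ 4` (`μ_rot = β_rot` there). [cite: Beaton2014RotatedHoneycomb, Proposition 7 (arXiv v3 p. 11), §3.1 (p. 12)] -/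
theorem rotSurfaceMu_pow_four_le (hy : 4 ≤ y) : rotSurfaceMu y ^ 4 ≤ y ^ 2 + 2 + 15309 / Real.sqrt y := by
  rw [rotSurfaceMu_eq_armRate_of_four_le hy]; exact armRate_pow_four_le (by linarith)

/-- **`μ_rot(y)² − y ∈ [1/(16y), 1/y + 7655/(y√y)]`** for `y ≥ 4`. [cite: Beaton2014RotatedHoneycomb, Proposition 7 (arXiv v3 p. 11), §3.1 (p. 12)] -/
theorem rotSurfaceMu_sq_sub_mem_Icc (hy : 4 ≤ y) :
    rotSurfaceMu y ^ 2 - y ∈ Set.Icc (1 / (16 * y)) (1 / y + 7655 / (y * Real.sqrt y)) := by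
  rw [rotSurfaceMu_eq_armRate_of_four_le hy]; exact armRate_sq_sub_mem_Icc (by linarith)

/-- **`y (μ_rot(y)² − y) ∈ [1/16, 1 + 7655/√y]`** for `y ≥ 4`: `limsup_{y→∞} y(μ_rot(y)² − y) ≤ 1`.
[cite: Beaton2014RotatedHoneycomb, Proposition 7 (arXiv v3 p. 11), §3.1 (p. 12)] -/
theorem mul_rotSurfaceMu_sq_sub_mem_Icc (hy : 4 ≤ y) :
    y * (rotSurfaceMu y ^ 2 - y) ∈ Set.Icc (1 / 16) (1 + 7655 / Real.sqrt y) := by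
  rw [rotSurfaceMu_eq_armRate_of_four_le hy]; exact mul_armRate_sq_sub_mem_Icc (by linarith)

/-- **`μ_rot(y)² − y = Θ(1/y)`** as `y → ∞`. [cite: Beaton2014RotatedHoneycomb, Proposition 7 (arXiv v3 p. 11), §3.1 (p. 12)] -/
theorem isTheta_rotSurfaceMu_sq_sub : (fun y : ℝ => rotSurfaceMu y ^ 2 - y) =Θ[atTop] (fun y : ℝ => 1 / y) := by
  refine isTheta_armRate_sq_sub.symm.trans_eventuallyEq ?_ |>.symm
  filter_upwards [eventually_ge_atTop (4 : ℝ)] with y hy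
  rw [rotSurfaceMu_eq_armRate_of_four_le hy]

/-- Eventually `y (μ_rot(y)² − y) ≤ 1 + ε` (every `ε > 0`). [cite: Beaton2014RotatedHoneycomb, §3.1 (arXiv v3 p. 12)] -/
theorem eventually_mul_rotSurfaceMu_sq_sub_le {ε : ℝ} (hε : 0 < ε) :
    ∀ᶠ y : ℝ in atTop, y * (rotSurfaceMu y ^ 2 - y) ≤ 1 + ε := by
  filter_upwards [eventually_mul_armRate_sq_sub_le hε, eventually_ge_atTop (4 : ℝ)] with y h hy
  rwa [rotSurfaceMu_eq_armRate_of_four_le hy]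

end Literature.Probability.RandomPlanarGeometry.SAW.HV
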